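import Summits.CriticalPhenomena.PercolationContinuityZ3.Theorems.PercShatteringRaceNearLinearTwoClusterDecaySplit
import Summits.CriticalPhenomena.PercolationContinuityZ3.Theorems.PercShatteringRaceNearLinearTwoClusterDecayPairDecayNullWorld
import Summits.CriticalPhenomena.PercolationContinuityZ3.Theorems.PercShatteringRaceNearLinearTwoClusterDecayChildTwoNullWorld
import Summits.CriticalPhenomena.PercolationContinuityZ3.Theorems.PercShatteringRaceNearLinearTwoClusterDecayChildTwoJumpWorld
import Summits.CriticalPhenomena.PercolationContinuityZ3.Theorems.PercShatteringRaceNearLinearTwoClusterDecayConsumedBoxLRO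
import Summits.CriticalPhenomena.PercolationContinuityZ3.Theorems.PercShatteringRaceNearLinearTwoClusterDecayStubLossyStep
import Summits.CriticalPhenomena.PercolationContinuityZ3.Theorems.PercShatteringRaceNearLinearTwoClusterDecayStubRelayChain
import Summits.CriticalPhenomena.PercolationContinuityZ3.Theorems.PercShatteringRaceNearLinearTwoClusterDecayStubBootstrapInit
import Summits.CriticalPhenomena.PercolationContinuityZ3.Theorems.PercShatteringRaceNearLinearTwoClusterDecayStubRelayBootstrap
import Summits.CriticalPhenomena.PercolationContinuityZ3.Theorems.PercShatteringRaceNearLinearTwoClusterDecayStubCritPairConnLower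
import Summits.CriticalPhenomena.PercolationContinuityZ3.Theorems.PercShatteringRaceNearLinearTwoClusterDecayStubCritAspectOfTwoArm
import Summits.CriticalPhenomena.PercolationContinuityZ3.Theorems.PercShatteringRaceNearLinearTwoClusterDecayStubCritTwoArmImproved
import Summits.CriticalPhenomena.PercolationContinuityZ3.Theorems.PercShatteringRaceNearLinearTwoClusterDecayCritFrontier
import Summits.CriticalPhenomena.PercolationContinuityZ3.Theorems.PercShatteringRaceNearLinearTwoClusterDecayCritFrontierStrict
import Summits.CriticalPhenomena.PercolationContinuityZ3.Theorems.PercShatteringRaceNearLinearTwoClusterDecayStubSuperCritPairConnLower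
import Summits.CriticalPhenomena.PercolationContinuityZ3.Theorems.PercShatteringRaceNearLinearTwoClusterDecayStubAspectOfTwoArmBdry
import Summits.CriticalPhenomena.PercolationContinuityZ3.Theorems.PercShatteringRaceNearLinearTwoClusterDecayCritFrontierAllP
import Summits.CriticalPhenomena.PercolationContinuityZ3.Theorems.PercShatteringRaceNearLinearTwoClusterDecayStubPairAspectOfTwoArm
import Summits.CriticalPhenomena.PercolationContinuityZ3.Theorems.PercShatteringRaceNearLinearTwoClusterDecayPairSelfImprove
import Summits.CriticalPhenomena.PercolationContinuityZ3.Theorems.NearLinearTwoClusterDecay.Negative.Structure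
import Summits.CriticalPhenomena.PercolationContinuityZ3.Theorems.PercShatteringRaceNearLinearTwoClusterDecayStubVdbdGoodPath
import Summits.CriticalPhenomena.PercolationContinuityZ3.Theorems.PercShatteringRaceNearLinearTwoClusterDecayStubVdbdAxisPaths
import Summits.CriticalPhenomena.PercolationContinuityZ3.Theorems.PercShatteringRaceNearLinearTwoClusterDecayStubVdbdCubeSurj
import Summits.CriticalPhenomena.PercolationContinuityZ3.Theorems.PercShatteringRaceNearLinearTwoClusterDecayStubVdbdChain
import Summits.CriticalPhenomena.PercolationContinuityZ3.Theorems.PercShatteringRaceNearLinearTwoClusterDecayStubAspectOfTwoArmBdryWide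
import Summits.CriticalPhenomena.PercolationContinuityZ3.Theorems.PercShatteringRaceNearLinearTwoClusterDecayStubVdbdCovering
import Summits.CriticalPhenomena.PercolationContinuityZ3.Theorems.PercShatteringRaceNearLinearTwoClusterDecayStubPairAspectOfTwoArmWide
import Literature.Probability.Percolation.CriticalContinuityProofs
import Literature.Probability.Percolation.CerfUniquenessZoneBound
import Literature.Barriers.CriticalPhenomena.KozmaNachmiasLemma11Steps
import HarnessLib

/-!
# Line `pair-decay-long-arms-dense` — crux `NearLinearTwoClusterDecay` (stmt-CriticalPhenomena-5785), skeleton rev L16-c13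

REV L16-c13 (after wave 2, lead c13): V3b `stub_vdbdCovering` p164298 and F1-wide `stub_pairAspectOfTwoArmWide` p164020 LANDED and imported —
ALL SEVEN § V stubs are closed; `critPairConnLower9'` (van den Berg–Don 2020 Cor 2, bond `ℤ³`), `critAtExponent_of_ge_38'`,
`critPairAtExponent_of_ge_30'`, `atExponent_status_38` are KERNEL-CLOSED in this file (union frontier 44 → 38, pair 36 → 30), and their
Theorems-side copies are LANDED: `…NearLinearTwoClusterDecayPointToPoint.lean` (p165427: `Theorems.critPointToPoint_lower` = Thm 1,
`Theorems.critPairConnLower9` = Cor 2) and `…NearLinearTwoClusterDecayCritFrontier38.lean` (p165734: `CritFrontier38.critAtExponent_of_gt_38`,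
`critAtExponent_of_ge_38`, `exists_critAtExponent_lt_38`, `critPairDecay_of_gt_30`, `critPairDecay_of_ge_30`, `atExponent_status_38`).
Remaining sorries = EXACTLY the two prepared children (STUCK); `NearLinearTwoClusterDecay_of` untouched.

REV L15-c13 (after wave 1, lead c13): V1 p163572, V2 p163280, V3a p163009, V4 p163031, V6 p162963 ALL LANDED and imported; NEW § wave 2
(end of file) registers V3b `stub_vdbdCovering` (= `Stubs.VdbdCovering`) and F1-wide `stub_pairAspectOfTwoArmWide`, with the closed
certificate chain `critPairConnLower9'` / `critAtExponent_of_ge_38'` / `critPairAtExponent_of_ge_30'` / `atExponent_status_38`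
(union frontier 44 → 38, pair 36 → 30, modulo exactly V3b and F1-wide).  Children unchanged OPEN/STUCK.

REV L14-c13 (lead c13, 2026-08-17; everything of rev L13-c10 below is kept byte-for-byte, plus one import
`KozmaNachmiasLemma11Steps`): NEW § Point-to-point frontier (end of file) — van den Berg–Don 2020 (arXiv:1912.10964,
Thm 1 / Cor 2: `P_{p_c}(x ↔ y in Λ_{9n}) ≥ c n^{-9}` on `Λ_n²`, the best pointwise two-point lower bound at `p_c` in
`d ∈ {3,…,6}`, NOT previously in the tree) registered as five frontier stubs V1 `stub_vdbdGoodPath`, V2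
`stub_vdbdAxisPaths`, V3a `stub_vdbdCubeSurj`, V4 `stub_vdbdChain`, V6 `stub_aspectOfTwoArmBdryWide`, with the
covering step V3b (`Stubs.VdbdCovering`, lead's) and the assembly `critPairConnLower9_of` PROVED here, and the
certificates `critAtExponent_of_gt_38` / `critAtExponent_of_ge_38`: the unconditional frontier of the crux family moves
`44 → 38` (`e = 12 → 9` in W5) once the § V stubs land.  HONEST SCOPE: exponent bookkeeping inside the AKN/Cerf counting
class (floor ≈ 5, AKN-count-budget-c6; STRATEGY-CENSUS s1 §6 "not progress toward 7/6") — recorded for the formal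
frontier and for the Literature-grade fact it lands; the two prepared children `stub_pairDecayJumpWorld` /
`stub_longArmsAreDense` stay OPEN/STUCK and the composition `NearLinearTwoClusterDecay_of` is untouched.

REV L13-c10 (lead c10, 2026-08-17; everything of rev L12-c8 below is kept byte-for-byte): NEW § Averaged profile (end of file) —
certificate `pairTwoArmsDecay_iff_avgPairDecay` LANDED (p156545, `…NearLinearTwoClusterDecayPairSelfImprove.lean`) and imported:
child 1 `PairTwoArmsDecay` (the consumed child) is EQUIVALENT, unconditionally, to its AVERAGED form `Stubs.AvgPairTwoArmsDecay`
(for every `x ∈ Λ(n)`: `Σ_{w ∈ Λ(n)} P(pairBad ⌈n^{7/6}⌉ x w) ≤ ε|Λ(n)|`) — `θ(p_c)=0`: p137652; `0<θ(p_c)`: first exits + density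
of `C_∞` in boxes + Markov on the bad-partner count.  So neither the sup over partners nor any rate carries child 1's difficulty:
its content is a pointed giant-uniqueness at aspect `n^{1/6}`.  Remaining sorries = EXACTLY the two prepared children (STUCK);
the composition `NearLinearTwoClusterDecay_of` is untouched.

REV L12-c8 (after wave 1): F1 `stub_pairAspectOfTwoArm` LANDED (p151874) and imported — remaining sorries = EXACTLY the two prepared children
(STUCK); the pair-form certificates below are kernel-closed (Theorems-side copy: `…NearLinearTwoClusterDecayPairFrontier.lean`).
REV L11-c8 (lead c8, 2026-08-17; everything of rev L10-c7 below is kept byte-for-byte): NEW § Pair-form frontier (end of file) —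
ONE frontier stub F1 `stub_pairAspectOfTwoArm` (the PAIR-form lossy step at a general parameter: Cerf Lemma 7.1 for one
deterministic pair, no union over pairs, so `κA > 6 + e` instead of W5's `10 + e`), the pair-form family `Stubs.PairAtExponent A`
(child 1 `PairTwoArmsDecay` = the instance `7/6`, `Iff.rfl`), `pairAtExponent_of_atExponent` (union ⇒ pair), and the certificates
`critPairAtExponent_of_gt'` / `critPairAtExponent_of_ge'`: with the landed W1 (`e = 12`) and W2 (`κ > 1/2`), `PairAtExponent A` for
EVERY `A ≥ 36` UNCONDITIONALLY (union form: `44`, p146707).  Exponent bookkeeping for the record of the child the route consumes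
(children.json child 1); the two prepared children `stub_pairDecayJumpWorld` / `stub_longArmsAreDense` stay OPEN/STUCK and the
composition `NearLinearTwoClusterDecay_of` is untouched.


REV L10-c7 (lead c7, 2026-08-17; mathematics of rev L9-c6 UNCHANGED byte-for-byte below this paragraph): re-checked on the farm after the build of
c6's modules — rc 0, errors [], sorries = EXACTLY the two prepared route-level children `stub_pairDecayJumpWorld`, `stub_longArmsAreDense`
(both STUCK = open problems; c4/c5/c6 promote-stub ×3, this seat ×4); `NearLinearTwoClusterDecay_of` concludes the crux BY NAME.  Nothing
bearing on the line changed since rev L9-c6 (Disproof v6 `-- Targets: none`; no new idea card / Literature fact / route edit; TTRL menus empty).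
This seat adds no stub: every honest frontier piece of the two-layer plan is landed (U₁: α* ≤ 44 unconditionally, p146707), and the residue
U₂ = aspect reduction 44 → 7/6 is the two children verbatim.  Planner-ready restate/split package: crux dir `RESTATE-5785-c7.md` +
`RestateCheck_c7.lean` (both options rendered in the route namespace and elaborated).

# (lead c5, 2026-08-17: rev L3-c4 unchanged + § Relay bootstrap — the line card's optional reshape of the
# jump-world half into the occupation-rate relay programme, typed against the tree's Cerf/DKT machinery)

REV L9-c6 (after wave 2): W4 `stub_superCritPairConnLower` p146251 (W1 at every p ≥ p_c) and W5 `stub_aspectOfTwoArmBdry` p146647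
(lossy step at parameter p with Cerf's BOUNDARY-pair count 4 + 6 + e) LANDED; certificate `…CritFrontierAllP.lean` p146707 LANDED:
`twoClusterDecay_of_gt_44` — for EVERY p < 1 and every A > 44 the crux event decays under P_p (subcritical by sharpness, p ≥ p_c by
W4 + W5 + AKN); at p_c `critAtExponent_of_gt_44` / `exists_critAtExponent_lt_44` / `critAtExponent_of_ge_44` (α* ≤ 44, strictly < 44:
Cerf's own count 22/κ; print site 22·23/12 = 42.17).  Remaining sorries = EXACTLY the two prepared children (STUCK).
REV L8-c6 (after wave 1): ALL THREE FRONTIER STUBS LANDED and imported — W1 `stub_critPairConnLower` p144917, W2 `stub_critTwoArmImproved`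
p145559 (aux `cube_mul_real_edgeTwoArms_le_crit` p145086), W3 `stub_critAspectOfTwoArm` p145039; certificates LANDED: `…CritFrontier.lean` p145562
(`critAtExponent_of_gt_48`: `AtExponent A` for every `A > 48`, UNCONDITIONAL — bond Cerf Thm 1.2 at `p_c(ℤ³)`), sequel `…CritFrontierStrict.lean`
p146064 (`exists_critAtExponent_lt_48`, `critAtExponent_of_ge_48`).  Remaining sorries = EXACTLY the two prepared children (STUCK).
REV L7b-c6: `stub_critAspectOfTwoArm` carries the explicit hypothesis `1 < A` (decay is false at `A ≤ 1`).
REV L7-c6 (lead c6, 2026-08-17): rev L6-c5 unchanged byte-for-byte below + § Unconditional frontier (end of file):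
the WORLD-FREE layer U₁ of the route's two-layer plan for BOND ℤ³, registered as three frontier stubs —
`stub_critPairConnLower` (W1: Duminil-Copin–Tassion φ_{p_c}(Λ_m) ≥ 1 + Cerf Lemma 6.1 chaining `AKN.bconn_two_point_lower`:
`P_{p_c}(a ↔ b in Λ_{2n}) ≥ c n^{-12}` on `Λ_n²`, unconditional), `stub_critTwoArmImproved` (W2: bond Cerf 2015 Thm 1.1 AT p_c,
unconditional — `∃ κ > 1/2, TwoArm κ`, the §8–§9 dyadic iteration re-run with the W1 input in place of θ; tree has it only
under `θ(p) > 0`, `Cerf2015BoxLRO16.real_edgeTwoArms_dyadic_le`), `stub_critAspectOfTwoArm` (W3: unconditional lossy step,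
Cerf Lemma 7.1 + Cor 7.2 divided by W1: `TwoArm κ ⇒` two-cluster decay at every exponent `A` with `κA > 24`).  Composition
(§ Unconditional frontier): `critAtExponent_of_gt` — `AtExponent A` for EVERY `A > 48`, UNCONDITIONALLY (W1 + W3 + the landed
`twoArm_of_lt_half`): the bond analogue of Cerf 2015 Thm 1.2 (print, site: α* ≤ 42.17; tree so far: 1 ≤ α* only, and aspect 48
only in the jump world p139331); and `critAtExponent_lt_48` — `∃ A < 48, AtExponent A` (W2).  The crux asserts α* ≤ 7/6; the two
children `stub_pairDecayJumpWorld`, `stub_longArmsAreDense` stay OPEN/STUCK (the composition `NearLinearTwoClusterDecay_of`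
is untouched; the frontier stubs are certificates, orphans w.r.t. it by design).

REV L6-c5 (lead c5): ALL FOUR ENGINE STUBS LANDED and imported — E1 `stub_lossyStep` p141141, E2 `stub_relayChain`
p142417 (aux p141546), E3 `stub_bootstrapInit` p140884, E4 `stub_relayBootstrap` p141088; the certificates
`jumpBoxLRO_of_twoArm_of_occRate` / `percolationContinuityZ3_of_powerSaving_of_twoArm_of_occRate` below are now
kernel-closed (their Theorems-side copies: `PercShatteringRaceNearLinearTwoClusterDecayRelayBootstrap.lean`,
`relayBootstrap_certificate`).  Remaining sorries = EXACTLY the two prepared route-level children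
`stub_pairDecayJumpWorld`, `stub_longArmsAreDense` (both STUCK, promote-stub material; see NOTES-c5.md).

REV L5-c5 (lead c5, textual reshape only): the engine stub STATEMENTS no longer contain the token `:=`
(`uniqZone (d := 3)` ↦ `@uniqZone 3`, no inline comments) — the skeleton registrar cuts a signature at the first
`:=`, which had truncated the rev L4-c5 registrations of E1–E4 at `(uniqZone (d`; and E4 is RENAMED
`stub_bootstrap` ↦ `stub_relayBootstrap` (`Theorems.stub_bootstrap` already exists in the tree — DefectDimension's —
so a stub file declaring it would bounce `dedup.fqn-exists`).  Mathematics unchanged.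

REV L4-c5 (lead c5).  Everything of rev L3-c4 below is kept byte-for-byte (two open stubs = the two prepared
route-level children, both STUCK).  NEW: § Relay bootstrap (end of file) registers four ENGINE stubs for the
jump-world half in its CONSUMED form `JumpBoxLRO b` (the hypothesis of the landed
`Theorems.NearLinearTwoClusterDecay.Consumed.raceLemma_of_jumpBoxLRO`, p125450):
* `stub_lossyStep`   — Cerf 2015 Lemma 7.1 + Cor 7.2 (bond, IN TREE: `AKN.real_twoArmsBox_mul_le`,
  `AKN.real_compl_uniqZone_le_sum`) fed with pair-LRO at aspect `x` and a two-arms exponent `κ`: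
  union-form two-cluster RATE at aspect `A` with exponent `ζ ≤ κA − 6 − 6x` (the TREE's count: `|Λ_u|²·m⁶`);
* `stub_relayChain`  — Harris–FKG `θ²` + a chain of `≍ n^{1−γ}` relay boxes of radius `n^γ` each meeting `C_∞`
  (paid with `OccRate σ`) + the two-cluster rate for consecutive relays: pair-LRO at every aspect `x > max 1 (γA)`;
* `stub_bootstrapInit` — `AKN.dkt_prop1` (DKT 2020 Prop 1, IN TREE) at `p = p_c ∈ (0,1)`: SOME two-cluster rate;
* `stub_relayBootstrap`   — pure real analysis: the round map `F(x) = max (1, (6+6x+σ)/(κ(1+σ)), x/(1+σ))` is a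
  contraction with fixed point `max (1, (6+σ)/(κ(1+σ)−6))`, so the three stubs give `JumpBoxLRO b` whenever
  `6 < κ(1+σ)` and `(6+σ)/(κ(1+σ)−6) < 1+b` (`b > 0`).
Composition (certificates, orphans w.r.t. `NearLinearTwoClusterDecay_of` by design): `jumpBoxLRO_of_twoArm_of_occRate`
(`TwoArm κ → OccRate σ → JumpBoxLRO b`) and `percolationContinuityZ3_of_powerSaving_of_twoArm_of_occRate`
(`S(a) ∧ TwoArm κ ∧ OccRate σ ⇒ θ(p_c) = 0`, instances `(a,b,κ,σ) = (1/2,1/6,9/5,10)`, `(9/10,2/5,9/5,8)`).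
HONEST SCOPE: the two inputs `TwoArm κ` (κ > 6/7 needed; tree: `1/2 − o(1)`, `AKN.exists_real_edgeTwoArms_le`;
print 12/23 site) and `OccRate σ` (jump-world occupation rate; no engine) are typed ATOMS taken as hypotheses,
never stubs; the programme certifies the route's consumed form modulo them and does NOT touch `U` as filed,
whose `θ(p_c) = 0` half (child 2) remains the d<6 residue.  `stub_pairDecayJumpWorld` (pair DECAY at 7/6) is
not implied by `JumpBoxLRO` (LRO ≠ decay) and stays registered, open, STUCK.

# rev L3-c4 header (lead c4, 2026-08-17; strategist's rev S2 with stub 1 RESHAPED BY WORLDS and the glue IMPORTED from Theorems)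

ARCHITECTURE (unchanged from rev S2): density sampling, no shell product, no per-shell constant.
The crux `U(1/6)` (union form) follows from the PAIR form `PairTwoArmsDecay` and the residue
`LongArmsAreDense` by the LANDED glue `Theorems.nearLinearTwoClusterDecay_of_subs`
(`PercShatteringRaceNearLinearTwoClusterDecaySplit{Core,}.lean`, p137356 + sequel).

RESHAPE (rev L1-c4): the pair form is split by worlds,
* `stub_pairDecayNullWorld : θ(p_c) = 0 → PairTwoArmsDecay` — CLOSED, landed p137652 (for `x ∈ Λ(n)`,
  `pairBad m x x' ⊆ {x reaches ∂ⁱⁿΛ(m) inside Λ(m)} ⊆ armEvent x (m - n)` by first exit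
  (`DCT16.armEvent_of_pathIn`, cf. `Negative.exists_armEvent_of_crossingEvt`), translation invariance
  `DCT16.real_armEvent`, and `P(0 ↔ ∂Λ_k) ↓ θ(p_c) = 0` (`tendsto_real_siteToBoundary`), with
  `m - n = ⌈n^{7/6}⌉ - n → ∞`);
* `stub_pairDecayJumpWorld : 0 < θ(p_c) → PairTwoArmsDecay` — the genuine content of child 1: in-box
  uniqueness of the infinite cluster at aspect `n^{1/6}` for a deterministic pair (Cerf 2015 Thm 1.3 has
  aspect `n^{16}`, site).  OPEN; engines on file: `Ideas/occupation-rate-relay-bootstrap.md`,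
  `Ideas/radial-freshness-sphere-gluing.md` (both deliver JumpBoxLRO, weaker than pair DECAY — recorded);
* `stub_longArmsAreDense` — unchanged, THE HARDEST STUB (lead's): `θ=0` world ⇒ polynomial-aspect
  crossing decay (hyperscaling-lite); jump world ⇒ no dust / no thin strands.  OPEN PROBLEM.
Composition: `PairTwoArmsDecay` by `by_cases` on `θ(p_c) = 0`, then `nearLinearTwoClusterDecay_of_subs`.

CERTIFIED WORLD PROFILE (rev L2-c4, wave 1; all LANDED, see § World profile below):
* `θ(p_c) = 0`: child 1 automatic (p137652); child 2 ⟺ in-box crossing decay at aspect 7/6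
  (`longArmsAreDense_iff_crossingDecay_of_theta_eq_zero`, p138392) — hyperscaling-lite, NOT implied by `U`;
  `U ⇐ child 2` alone (`NearLinearTwoClusterDecay_of_theta_eq_zero`).
* `0 < θ(p_c)`: `U ⟺ child 1 ∧ child 2` (`nearLinearTwoClusterDecay_iff_pair_and_longArmsAreDense_of_theta_pos`,
  p138671: the split is LOSSLESS in the jump world; child 2 ⇐ U via the density of `C_∞` in boxes).
* Worker verdict on `stub_pairDecayJumpWorld` (wave 1): stub-blocked — the tree's jump-world in-box facts are bond
  Cerf Thm 1.3 = LRO at aspect `n^{16}` (`Theorems.cerf2015BoxLRO16_proof`, stmt-0860 closed) and `AKN.dkt_prop1`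
  (uniqueness zone at aspect `n^{220}`, uniform in `p`); union ⊇ pair DECAY only above aspect ≈ `n^{47}`; the missing
  statement is a jump-world aspect reduction `0 < θ(p_c) → ∃ α ∈ [1, 7/6], Negative.AtExponent α` — i.e. the
  sibling crux `PercFiniteBoxLRO.CritBoxTwoArmsDecay` (stmt-0859) at an instance `α ≤ 7/6`, which is this crux.
* FRONTIER (wave 2, p139331): in the jump world (indeed for every `p < 1` with `θ(p) > 0`) the union-form two-cluster
  event DECAYS at aspect `n^{48}` — `twoClusterDecay_aspect48_of_theta_pos` (Cerf counting `k^{24}` × `τ(M)√M → 0`;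
  `48 = 2·24` is sharp for the tree's count).  So `stub_pairDecayJumpWorld` holds at aspect 48; the crux needs `7/6`.
So both open stubs are exactly the two proposed route-level children; nothing provable remains inside the line.
-/

noncomputable section

namespace Summit.CriticalPhenomena.PercolationContinuityZ3.Cruxes.NearLinearTwoClusterDecay.PairDecayLongArmsDense

-- every `Summit.CriticalPhenomena.PercolationContinuityZ3.…` name repeats the summit segment (D-0017 layout)
set_option linter.dupNamespace false

open MeasureTheory Filter Topology
open Literature.Probability.LatticeModels Literature.Probability.Percolation
open Summit.CriticalPhenomena.PercolationContinuityZ3.Theses.PercShatteringRace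
open Summit.CriticalPhenomena.PercolationContinuityZ3.Theorems

/-! ## The registered stubs as precise `Prop`s -/

namespace Stubs

/-- The PAIR form of `U(1/6)` (= proposed child `PairTwoArmsDecay` verbatim). -/
def PairTwoArmsDecay : Prop :=
    ∀ ε : ℝ, 0 < ε → ∀ᶠ n : ℕ in Filter.atTop, ∀ x ∈ box 3 n, ∀ x' ∈ box 3 n,
      (bondPercolation (zdGraph 3) (criticalProbI 3)).real
        {ω | ∃ y ∈ innerBoundary (zdGraph 3) (box 3 ⌈(n : ℝ) ^ ((7 : ℝ) / 6)⌉₊),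
          ∃ y' ∈ innerBoundary (zdGraph 3) (box 3 ⌈(n : ℝ) ^ ((7 : ℝ) / 6)⌉₊),
            ω ∈ openConnIn ↑(box 3 ⌈(n : ℝ) ^ ((7 : ℝ) / 6)⌉₊) x y ∧
            ω ∈ openConnIn ↑(box 3 ⌈(n : ℝ) ^ ((7 : ℝ) / 6)⌉₊) x' y' ∧
            ω ∉ openConnIn ↑(box 3 ⌈(n : ℝ) ^ ((7 : ℝ) / 6)⌉₊) x x'} ≤ ε

/-- **Stub `Prop` 1a (`pairDecayNullWorld`, provable now).** -/
def stub_pairDecayNullWorld : Prop :=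
    theta (zdGraph 3) 0 (criticalProbI 3) = 0 → PairTwoArmsDecay

/-- **Stub `Prop` 1b (`pairDecayJumpWorld`, the consumed content; OPEN).** -/
def stub_pairDecayJumpWorld : Prop :=
    0 < theta (zdGraph 3) 0 (criticalProbI 3) → PairTwoArmsDecay

/-- **Stub `Prop` 2 (`LongArmsAreDense`, the residue; HARDEST; = proposed child 2 verbatim).** -/
def stub_longArmsAreDense : Prop :=
    ∀ ε : ℝ, 0 < ε → ∃ κ : ℝ, 0 < κ ∧ ∀ᶠ n : ℕ in Filter.atTop,
      (bondPercolation (zdGraph 3) (criticalProbI 3)).real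
        {ω | ∃ x ∈ box 3 n,
          (∃ y ∈ innerBoundary (zdGraph 3) (box 3 ⌈(n : ℝ) ^ ((7 : ℝ) / 6)⌉₊),
            ω ∈ openConnIn ↑(box 3 ⌈(n : ℝ) ^ ((7 : ℝ) / 6)⌉₊) x y) ∧
          (Set.ncard {z : Site 3 | z ∈ box 3 n ∧
              ω ∈ openConnIn ↑(box 3 ⌈(n : ℝ) ^ ((7 : ℝ) / 6)⌉₊) x z} : ℝ) < κ * (box 3 n).card} ≤ ε

end Stubs

/-! ## The REGISTERED STUBS (sorried; statements spelled out exactly as registered) -/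

/-- **Stub 1a (`pairDecayNullWorld`).** In the orthodox world `θ(p_c) = 0` the pair form is
automatic: for `x ∈ Λ(n)` the pair event is contained in "`x` reaches `∂ⁱⁿΛ(m)` inside `Λ(m)`",
`m = ⌈n^{7/6}⌉`, whose probability is at most `P(0 ↔ ∂Λ_{m-n}) ↓ θ(p_c) = 0`, uniformly in the
pair.  PROVABLE NOW. -/
theorem stub_pairDecayNullWorld :
    theta (zdGraph 3) 0 (criticalProbI 3) = 0 →
    ∀ ε : ℝ, 0 < ε → ∀ᶠ n : ℕ in Filter.atTop, ∀ x ∈ box 3 n, ∀ x' ∈ box 3 n,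
      (bondPercolation (zdGraph 3) (criticalProbI 3)).real
        {ω | ∃ y ∈ innerBoundary (zdGraph 3) (box 3 ⌈(n : ℝ) ^ ((7 : ℝ) / 6)⌉₊),
          ∃ y' ∈ innerBoundary (zdGraph 3) (box 3 ⌈(n : ℝ) ^ ((7 : ℝ) / 6)⌉₊),
            ω ∈ openConnIn ↑(box 3 ⌈(n : ℝ) ^ ((7 : ℝ) / 6)⌉₊) x y ∧
            ω ∈ openConnIn ↑(box 3 ⌈(n : ℝ) ^ ((7 : ℝ) / 6)⌉₊) x' y' ∧
            ω ∉ openConnIn ↑(box 3 ⌈(n : ℝ) ^ ((7 : ℝ) / 6)⌉₊) x x'} ≤ ε :=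
  -- CLOSED: landed as `Theorems.stub_pairDecayNullWorld` (p137652)
  Summit.CriticalPhenomena.PercolationContinuityZ3.Theorems.stub_pairDecayNullWorld

/-- **Stub 1b (`pairDecayJumpWorld`, the consumed content).** In a jump world `θ(p_c) > 0`: for
every `ε > 0`, eventually in `n`, for ALL deterministic `x, x' ∈ Λ(n)`, the probability that both
reach `∂ⁱⁿΛ(m)` inside `Λ(m)`, `m = ⌈n^{7/6}⌉`, without being joined inside `Λ(m)` is `≤ ε` —
in-box uniqueness of the infinite cluster at aspect `n^{1/6}` (Cerf 2015 Thm 1.3: `n^{16}`; bond version landed as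
`Theorems.cerf2015BoxLRO16_proof`, LRO not decay).  OPEN — wave-1 worker: stub-blocked (nearest existing statement
implying it: stmt-0859 `CritBoxTwoArmsDecay` at an instance `α ≤ 7/6`; no tree/print fact gives jump-world two-cluster
decay for bond `ℤ³` below aspect ≈ `n^{47}`). -/
theorem stub_pairDecayJumpWorld :
    0 < theta (zdGraph 3) 0 (criticalProbI 3) →
    ∀ ε : ℝ, 0 < ε → ∀ᶠ n : ℕ in Filter.atTop, ∀ x ∈ box 3 n, ∀ x' ∈ box 3 n,
      (bondPercolation (zdGraph 3) (criticalProbI 3)).real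
        {ω | ∃ y ∈ innerBoundary (zdGraph 3) (box 3 ⌈(n : ℝ) ^ ((7 : ℝ) / 6)⌉₊),
          ∃ y' ∈ innerBoundary (zdGraph 3) (box 3 ⌈(n : ℝ) ^ ((7 : ℝ) / 6)⌉₊),
            ω ∈ openConnIn ↑(box 3 ⌈(n : ℝ) ^ ((7 : ℝ) / 6)⌉₊) x y ∧
            ω ∈ openConnIn ↑(box 3 ⌈(n : ℝ) ^ ((7 : ℝ) / 6)⌉₊) x' y' ∧
            ω ∉ openConnIn ↑(box 3 ⌈(n : ℝ) ^ ((7 : ℝ) / 6)⌉₊) x x'} ≤ ε := by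
  sorry

/-- **Stub 2 (`LongArmsAreDense`, the residue; HARDEST).** For every `ε > 0` there is `κ > 0` such that
eventually `P(∃ x ∈ Λ(n)` with an in-box arm to `∂ⁱⁿΛ(⌈n^{7/6}⌉)` and a `Λ(n)`-trace of its
`Λ(m)`-cluster smaller than `κ|Λ(n)|) ≤ ε`.  Real world: polynomial-aspect crossing decay
(hyperscaling-lite); jump world: no dust / no thin strands.  OPEN PROBLEM. -/
theorem stub_longArmsAreDense :
    ∀ ε : ℝ, 0 < ε → ∃ κ : ℝ, 0 < κ ∧ ∀ᶠ n : ℕ in Filter.atTop,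
      (bondPercolation (zdGraph 3) (criticalProbI 3)).real
        {ω | ∃ x ∈ box 3 n,
          (∃ y ∈ innerBoundary (zdGraph 3) (box 3 ⌈(n : ℝ) ^ ((7 : ℝ) / 6)⌉₊),
            ω ∈ openConnIn ↑(box 3 ⌈(n : ℝ) ^ ((7 : ℝ) / 6)⌉₊) x y) ∧
          (Set.ncard {z : Site 3 | z ∈ box 3 n ∧
              ω ∈ openConnIn ↑(box 3 ⌈(n : ℝ) ^ ((7 : ℝ) / 6)⌉₊) x z} : ℝ) < κ * (box 3 n).card} ≤ ε := by
  sorry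

/-! ## Composition -/

/-- The pair form from its two world-halves (excluded middle on `θ(p_c) = 0`; `θ ≥ 0` always). [folklore] -/
theorem pairTwoArmsDecay_of_worlds (h₀ : Stubs.stub_pairDecayNullWorld) (h₁ : Stubs.stub_pairDecayJumpWorld) :
    Stubs.PairTwoArmsDecay := by
  by_cases hθ : theta (zdGraph 3) 0 (criticalProbI 3) = 0
  · exact h₀ hθ
  · exact h₁ (lt_of_le_of_ne measureReal_nonneg (Ne.symm hθ))

/-- **COMPOSITION `NearLinearTwoClusterDecay_of`** — hypotheses = the three stub `Prop`s BY NAME, conclusion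
the crux BY NAME: the pair form by worlds, then the landed split glue
`Theorems.nearLinearTwoClusterDecay_of_subs` (density sampling). [folklore] -/
theorem NearLinearTwoClusterDecay_of (h₀ : Stubs.stub_pairDecayNullWorld) (h₁ : Stubs.stub_pairDecayJumpWorld)
    (h₂ : Stubs.stub_longArmsAreDense) :
    Summit.CriticalPhenomena.PercolationContinuityZ3.Theses.PercShatteringRace.NearLinearTwoClusterDecay :=
  nearLinearTwoClusterDecay_of_subs (pairTwoArmsDecay_of_worlds h₀ h₁) h₂

/-- In the orthodox world the line needs only stub 1a and stub 2:
`θ(p_c) = 0 → pairDecayNullWorld → LongArmsAreDense → U`. [folklore] -/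
theorem NearLinearTwoClusterDecay_of_theta_eq_zero (hθ : theta (zdGraph 3) 0 (criticalProbI 3) = 0)
    (h₀ : Stubs.stub_pairDecayNullWorld) (h₂ : Stubs.stub_longArmsAreDense) :
    Summit.CriticalPhenomena.PercolationContinuityZ3.Theses.PercShatteringRace.NearLinearTwoClusterDecay :=
  nearLinearTwoClusterDecay_of_subs (h₀ hθ) h₂

/-! ## World profile (certified; all pieces LANDED under `Theorems/`) -/

/-- `θ(p_c) = 0`: child 2 is EXACTLY in-box crossing decay at aspect `7/6` (p138392). [folklore] -/
theorem childTwo_iff_crossingDecay_of_theta_eq_zero (hθ : theta (zdGraph 3) 0 (criticalProbI 3) = 0) :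
    Stubs.stub_longArmsAreDense ↔
    Tendsto (fun n : ℕ => (bondPercolation (zdGraph 3) (criticalProbI 3)).real
      {ω | ∃ x ∈ box 3 n, ∃ y ∈ innerBoundary (zdGraph 3) (box 3 ⌈(n : ℝ) ^ ((7 : ℝ) / 6)⌉₊),
        ω ∈ openConnIn ↑(box 3 ⌈(n : ℝ) ^ ((7 : ℝ) / 6)⌉₊) x y}) atTop (𝓝 0) :=
  longArmsAreDense_iff_crossingDecay_of_theta_eq_zero hθ

/-- `0 < θ(p_c)`: the crux implies child 2 (p138671; density of `C_∞` in boxes, no Kesten–Zhang). [folklore] -/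
theorem childTwo_of_theta_pos_of_crux (hθ : 0 < theta (zdGraph 3) 0 (criticalProbI 3))
    (hU : Summit.CriticalPhenomena.PercolationContinuityZ3.Theses.PercShatteringRace.NearLinearTwoClusterDecay) :
    Stubs.stub_longArmsAreDense :=
  longArmsAreDense_of_theta_pos_of_nearLinearTwoClusterDecay hθ hU

/-- `0 < θ(p_c)`: the split is LOSSLESS — `U ↔ child 1 ∧ child 2` (p138671 + glue p137625). [folklore] -/
theorem crux_iff_children_of_theta_pos (hθ : 0 < theta (zdGraph 3) 0 (criticalProbI 3)) :
    Summit.CriticalPhenomena.PercolationContinuityZ3.Theses.PercShatteringRace.NearLinearTwoClusterDecay ↔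
    Stubs.PairTwoArmsDecay ∧ Stubs.stub_longArmsAreDense :=
  nearLinearTwoClusterDecay_iff_pair_and_longArmsAreDense_of_theta_pos hθ

/-- **The crux by worlds, through this line**: `U` holds iff (orthodox world ⇒ `U`) and (jump world ⇒ both
children); and in the orthodox world child 2 alone suffices.  This is the exact residual content of the two
open stubs. [folklore] -/
theorem crux_iff_worldProfile :
    Summit.CriticalPhenomena.PercolationContinuityZ3.Theses.PercShatteringRace.NearLinearTwoClusterDecay ↔
    (theta (zdGraph 3) 0 (criticalProbI 3) = 0 →
      Summit.CriticalPhenomena.PercolationContinuityZ3.Theses.PercShatteringRace.NearLinearTwoClusterDecay) ∧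
    (0 < theta (zdGraph 3) 0 (criticalProbI 3) → Stubs.PairTwoArmsDecay ∧ Stubs.stub_longArmsAreDense) := by
  constructor
  · exact fun hU => ⟨fun _ => hU, fun hθ => (crux_iff_children_of_theta_pos hθ).1 hU⟩
  · rintro ⟨h0, h1⟩
    by_cases hθ : theta (zdGraph 3) 0 (criticalProbI 3) = 0
    · exact h0 hθ
    · have hpos : 0 < theta (zdGraph 3) 0 (criticalProbI 3) := lt_of_le_of_ne measureReal_nonneg (Ne.symm hθ)
      exact (crux_iff_children_of_theta_pos hpos).2 (h1 hpos)

/-- The stub `Prop`s are the sorried stub theorems' statements (definitional consistency). [folklore] -/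
theorem stubs_consistent :
    (Stubs.stub_pairDecayNullWorld ↔ (theta (zdGraph 3) 0 (criticalProbI 3) = 0 → Stubs.PairTwoArmsDecay)) ∧
    (Stubs.stub_pairDecayJumpWorld ↔ (0 < theta (zdGraph 3) 0 (criticalProbI 3) → Stubs.PairTwoArmsDecay)) :=
  ⟨Iff.rfl, Iff.rfl⟩

/-- **The skeleton IS the crux proof once the three stubs are discharged** (its only non-standard axiom is the
`sorryAx` of the stubs). [folklore] -/
theorem NearLinearTwoClusterDecay_proof :
    Summit.CriticalPhenomena.PercolationContinuityZ3.Theses.PercShatteringRace.NearLinearTwoClusterDecay :=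
  NearLinearTwoClusterDecay_of stub_pairDecayNullWorld stub_pairDecayJumpWorld stub_longArmsAreDense

/-! ## § Relay bootstrap (rev L4-c5): the jump-world half in its CONSUMED form, modulo two typed atoms

Vocabulary (all events over existing tree declarations: `openConnIn`, `percolatesAt`, `AKN.edgeTwoArms`,
`uniqZone`).  Every jump-world predicate is GUARDED by `0 < θ(p_c)` (vacuous in the orthodox world). -/

namespace Stubs

/-- `P_{p_c}` on `ℤ³` (bond). -/
abbrev Pc : Measure (BondConfig (Site 3)) := bondPercolation (zdGraph 3) (criticalProbI 3)

/-- `θ(p_c)`. -/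
abbrev θc : ℝ := theta (zdGraph 3) 0 (criticalProbI 3)

/-- **The CONSUMED form of the crux** (verbatim the LRO hypothesis of the landed
`Theorems.NearLinearTwoClusterDecay.Consumed.raceLemma_of_jumpBoxLRO`, p125450): in the jump world,
in-box long-range order from the centre at aspect `n^{1+b}`. -/
def JumpBoxLRO (b : ℝ) : Prop :=
  0 < θc → ∃ c : ℝ, 0 < c ∧ ∀ᶠ n : ℕ in atTop, ∀ y ∈ box 3 n,
    c ≤ Pc.real (openConnIn (↑(box 3 ⌈(n : ℝ) ^ (1 + b)⌉₊) : Set (Site 3)) 0 y)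

/-- **Pair LRO at aspect exponent `x`** (jump world): all pairs of `Λ_u` are joined inside `Λ_{⌈u^x⌉}`
with probability `≥ δ`, eventually in `u`. -/
def PairLRO (x : ℝ) : Prop :=
  0 < θc → ∃ δ : ℝ, 0 < δ ∧ ∀ᶠ u : ℕ in atTop, ∀ a ∈ box 3 u, ∀ b ∈ box 3 u,
    δ ≤ Pc.real (openConnIn (↑(box 3 ⌈(u : ℝ) ^ x⌉₊) : Set (Site 3)) a b)

/-- **ATOM `OccRate σ`** (jump world; NO ENGINE KNOWN — hypothesis only, never a stub): a box of radius
`u` misses the infinite cluster with probability `≤ C u^{-σ}`. -/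
def OccRate (σ : ℝ) : Prop :=
  0 < θc → ∃ C : ℝ, ∀ u : ℕ, 1 ≤ u →
    Pc.real {ω | ∀ x ∈ box 3 u, ω ∉ percolatesAt x} ≤ C * (u : ℝ) ^ (-σ)

/-- **ATOM `TwoArm κ`** (UNCONDITIONAL at `p_c`; hypothesis only, never a stub): the two-arms event of an
edge at scale `m` (`AKN.edgeTwoArms`) has probability `≤ C m^{-κ}`.  Tree: every `κ < 1/2`
(`AKN.exists_real_edgeTwoArms_le`, `(1 + log m)/√m`); print (site): every `κ < 12/23` (Cerf 2015 Thm 1.1). -/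
def TwoArm (κ : ℝ) : Prop :=
  ∃ C : ℝ, ∀ i : Fin 3, ∀ m : ℕ, 1 ≤ m → Pc.real (AKN.edgeTwoArms i m) ≤ C * (m : ℝ) ^ (-κ)

/-- **Two-cluster (union-form) RATE at aspect `A` with exponent `ζ`** (jump-world guarded):
`P_{p_c}((uniqZone u ⌈u^A⌉)ᶜ) ≤ C u^{-ζ}` eventually in `u`. -/
def TwoClusterRate (A ζ : ℝ) : Prop :=
  0 < θc → ∃ C : ℝ, ∀ᶠ u : ℕ in atTop,
    Pc.real (@uniqZone 3 u ⌈(u : ℝ) ^ A⌉₊)ᶜ ≤ C * (u : ℝ) ^ (-ζ)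

/-- **Engine stub `Prop` E1 (`lossyStep`).** -/
def stub_lossyStep : Prop :=
  ∀ x κ A : ℝ, 1 ≤ x → 0 < κ → x < A → TwoArm κ → PairLRO x →
    ∀ ζ : ℝ, ζ ≤ κ * A - 6 - 6 * x → TwoClusterRate A ζ

/-- **Engine stub `Prop` E2 (`relayChain`).** -/
def stub_relayChain : Prop :=
  ∀ σ A ζ γ : ℝ, 0 < σ → 1 ≤ A → 0 < ζ → 1 / (1 + σ) < γ → 1 / (1 + ζ) < γ → γ ≤ 1 →
    OccRate σ → TwoClusterRate A ζ → ∀ x : ℝ, max 1 (γ * A) < x → PairLRO x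

/-- **Engine stub `Prop` E3 (`bootstrapInit`).** -/
def stub_bootstrapInit : Prop :=
  ∃ A ζ : ℝ, 1 ≤ A ∧ 0 < ζ ∧ TwoClusterRate A ζ

/-- **Engine stub `Prop` E4 (`bootstrap`; pure real analysis over E1–E3).** -/
def stub_relayBootstrap : Prop :=
  stub_relayChain → stub_lossyStep → stub_bootstrapInit →
    ∀ κ σ b : ℝ, 0 < κ → 0 < σ → 0 < b → 6 < κ * (1 + σ) → (6 + σ) / (κ * (1 + σ) - 6) < 1 + b →
      TwoArm κ → OccRate σ → JumpBoxLRO b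

end Stubs

/-- **Engine stub E1 (`lossyStep`) — Cerf 2015 Lemma 7.1 + Corollary 7.2 (bond, both IN TREE) at relay
scale.**  For `1 ≤ x < A`, `κ > 0`: pair-LRO at aspect `x` (`P(a ↔ b in Λ_{⌈u^x⌉}) ≥ δ` on `Λ_u²`) and
`TwoArm κ` give, with `m = ⌈u^x⌉₊`, `M = ⌈u^A⌉₊`,
`P((uniqZone u M)ᶜ) ≤ Σ_{a,b ∈ Λ_u} P(twoArmsBox u (M-u) a b)` (`AKN.real_compl_uniqZone_le_sum`)
`≤ |Λ_u|² · (1 + |E(Λ_{m+1})|/p_c) |Λ_{m+1}| (Σ_i P(edgeTwoArms i (M-m-2))) / δ` (`AKN.real_twoArmsBox_mul_le`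
with `n = u`, `n+k = m`, `n+ℓ = M`, dividing by `δ ≤ P(a ↔ b via Λ_m)`; `openConnIn ↔ openConnVia withinGraph`
on lattice configurations) `≤ C u^{6} u^{6x} u^{-κA} = C u^{-(κA-6-6x)}` eventually. PROVABLE NOW. -/
theorem stub_lossyStep :
    ∀ x κ A : ℝ, 1 ≤ x → 0 < κ → x < A →
    (∃ C : ℝ, ∀ i : Fin 3, ∀ m : ℕ, 1 ≤ m →
      (bondPercolation (zdGraph 3) (criticalProbI 3)).real (AKN.edgeTwoArms i m) ≤ C * (m : ℝ) ^ (-κ)) →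
    (0 < theta (zdGraph 3) 0 (criticalProbI 3) → ∃ δ : ℝ, 0 < δ ∧ ∀ᶠ u : ℕ in atTop,
      ∀ a ∈ box 3 u, ∀ b ∈ box 3 u,
        δ ≤ (bondPercolation (zdGraph 3) (criticalProbI 3)).real
          (openConnIn (↑(box 3 ⌈(u : ℝ) ^ x⌉₊) : Set (Site 3)) a b)) →
    ∀ ζ : ℝ, ζ ≤ κ * A - 6 - 6 * x →
    (0 < theta (zdGraph 3) 0 (criticalProbI 3) → ∃ C : ℝ, ∀ᶠ u : ℕ in atTop,
      (bondPercolation (zdGraph 3) (criticalProbI 3)).real (@uniqZone 3 u ⌈(u : ℝ) ^ A⌉₊)ᶜ ≤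
        C * (u : ℝ) ^ (-ζ)) :=
  -- CLOSED: landed as `Theorems.stub_lossyStep` (p141141, wave 1)
  Summit.CriticalPhenomena.PercolationContinuityZ3.Theorems.stub_lossyStep

/-- **Engine stub E2 (`relayChain`) — the occupation-rate relay.**  In the jump world, for `a, b ∈ Λ_n`:
`P(a, b ∈ C_∞) ≥ θ²` (Harris–FKG, `theta_sq_le_real_openConnIn_add` pattern); a chain
`a = z₀, …, z_J = b` in `Λ_n` with `|z_{j+1} − z_j|_∞ ≤ r = ⌈n^γ⌉₊`, `J ≤ 7 n^{1-γ} + 3`; each relay box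
`z_j + Λ_r` meets `C_∞` except with probability `≤ C r^{-σ}` (`OccRate`, translation invariance
`bondPercolation_real_preimage_shift`); consecutive infinite strands both meet `z_j + Λ_{2r}` and reach
`∂ⁱⁿ(z_j + Λ_{M'})`, `M' = ⌈(2r)^A⌉₊` (first exit, `toBdry_of_percolatesAt`), so on the translate of
`uniqZone (2r) M'` they are joined inside `z_j + Λ_{M'} ⊆ Λ_{⌈n^x⌉₊}` (`n + 4^A n^{γA} + 1 ≤ n^x` eventually,
as `x > 1`, `x > γA`); chaining, `P(a ↔ b in Λ_{⌈n^x⌉₊}) ≥ θ² − (J+1) C r^{-σ} − J C' (2r)^{-ζ} ≥ θ²/2`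
eventually (`γ(1+σ) > 1`, `γ(1+ζ) > 1`). PROVABLE NOW. -/
theorem stub_relayChain :
    ∀ σ A ζ γ : ℝ, 0 < σ → 1 ≤ A → 0 < ζ → 1 / (1 + σ) < γ → 1 / (1 + ζ) < γ → γ ≤ 1 →
    (0 < theta (zdGraph 3) 0 (criticalProbI 3) → ∃ C : ℝ, ∀ u : ℕ, 1 ≤ u →
      (bondPercolation (zdGraph 3) (criticalProbI 3)).real
        {ω | ∀ x ∈ box 3 u, ω ∉ percolatesAt x} ≤ C * (u : ℝ) ^ (-σ)) →
    (0 < theta (zdGraph 3) 0 (criticalProbI 3) → ∃ C : ℝ, ∀ᶠ u : ℕ in atTop,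
      (bondPercolation (zdGraph 3) (criticalProbI 3)).real (@uniqZone 3 u ⌈(u : ℝ) ^ A⌉₊)ᶜ ≤
        C * (u : ℝ) ^ (-ζ)) →
    ∀ x : ℝ, max 1 (γ * A) < x →
    (0 < theta (zdGraph 3) 0 (criticalProbI 3) → ∃ δ : ℝ, 0 < δ ∧ ∀ᶠ u : ℕ in atTop,
      ∀ a ∈ box 3 u, ∀ b ∈ box 3 u,
        δ ≤ (bondPercolation (zdGraph 3) (criticalProbI 3)).real
          (openConnIn (↑(box 3 ⌈(u : ℝ) ^ x⌉₊) : Set (Site 3)) a b)) :=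
  -- CLOSED: landed as `Theorems.stub_relayChain` (p142417, aux p141546; wave 1 + lead)
  Summit.CriticalPhenomena.PercolationContinuityZ3.Theorems.stub_relayChain

/-- **Engine stub E3 (`bootstrapInit`) — DKT 2020 Proposition 1 at `p_c`.**  `p_c(ℤ³) ∈ (0,1)`
(`Grimmett1999_criticalProb_pos_lt_one_holds`), so `AKN.dkt_prop1` (d = 3, `δ = min p_c (1-p_c)`) gives
`α ∈ (0,1)`, `n₁` with `P_{p_c}((uniqZone ⌊n^α⌋₊ n)ᶜ) ≤ n^{-α}` for `n ≥ n₁`; with `A = 2/α`, `N = ⌈u^A⌉₊`: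
`⌊N^α⌋₊ ≥ u`, `uniqZone` is antitone in the inner radius (more pairs quantified), hence
`P((uniqZone u N)ᶜ) ≤ P((uniqZone ⌊N^α⌋₊ N)ᶜ) ≤ N^{-α} ≤ u^{-2}` eventually: `TwoClusterRate (2/α) 2`
(unconditionally, so a fortiori under the guard). PROVABLE NOW. -/
theorem stub_bootstrapInit :
    ∃ A ζ : ℝ, 1 ≤ A ∧ 0 < ζ ∧
    (0 < theta (zdGraph 3) 0 (criticalProbI 3) → ∃ C : ℝ, ∀ᶠ u : ℕ in atTop,
      (bondPercolation (zdGraph 3) (criticalProbI 3)).real (@uniqZone 3 u ⌈(u : ℝ) ^ A⌉₊)ᶜ ≤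
        C * (u : ℝ) ^ (-ζ)) :=
  -- CLOSED: landed as `Theorems.stub_bootstrapInit` (p140884, wave 1)
  Summit.CriticalPhenomena.PercolationContinuityZ3.Theorems.stub_bootstrapInit

/-- **Engine stub E4 (`bootstrap`) — pure real analysis over E1–E3.**  Given `TwoArm κ`, `OccRate σ`,
`0 < θ(p_c)`: E3 + E2 (with `γ = 1`) give `PairLRO x₀` for some `x₀ ≥ 1`; one ROUND = E1 then E2:
`PairLRO x` (x ≥ 1) ⟹ `PairLRO x'` for every `x' > F(x) := max (1, (6+6x+σ)/(κ(1+σ)), x/(1+σ))`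
(case `(6+6x+σ)/κ > x`: `A = (6+6x+σ)/κ`, `ζ = σ`, `γ ↓ 1/(1+σ)`; else `A = x + t`, `t ↓ 0`,
`ζ = κ(x+t) − 6 − 6x ≥ σ`); `F` is a `max` of contractions (slopes `0`, `6/(κ(1+σ)) < 1`, `1/(1+σ) < 1`)
with fixed point `x_F = max (1, (6+σ)/(κ(1+σ)−6)) < 1 + b`, so finitely many rounds (with slack `ε`) reach
`PairLRO x` for some `x ≤ 1 + b`; `PairLRO` is monotone in `x` (`openConnIn` monotone in the box), and
`PairLRO (1+b) → JumpBoxLRO b` (take `a = 0`). PROVABLE NOW (no percolation content beyond unfolding). -/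
theorem stub_relayBootstrap :
    (∀ σ A ζ γ : ℝ, 0 < σ → 1 ≤ A → 0 < ζ → 1 / (1 + σ) < γ → 1 / (1 + ζ) < γ → γ ≤ 1 →
      (0 < theta (zdGraph 3) 0 (criticalProbI 3) → ∃ C : ℝ, ∀ u : ℕ, 1 ≤ u →
          (bondPercolation (zdGraph 3) (criticalProbI 3)).real {ω | ∀ x ∈ box 3 u, ω ∉ percolatesAt x} ≤ C * (u : ℝ) ^ (-σ)) →
      (0 < theta (zdGraph 3) 0 (criticalProbI 3) → ∃ C : ℝ, ∀ᶠ u : ℕ in atTop,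
          (bondPercolation (zdGraph 3) (criticalProbI 3)).real (@uniqZone 3 u ⌈(u : ℝ) ^ A⌉₊)ᶜ ≤ C * (u : ℝ) ^ (-ζ)) →
      ∀ x : ℝ, max 1 (γ * A) < x →
      (0 < theta (zdGraph 3) 0 (criticalProbI 3) → ∃ δ : ℝ, 0 < δ ∧ ∀ᶠ u : ℕ in atTop, ∀ a ∈ box 3 u, ∀ b ∈ box 3 u,
          δ ≤ (bondPercolation (zdGraph 3) (criticalProbI 3)).real (openConnIn (↑(box 3 ⌈(u : ℝ) ^ x⌉₊) : Set (Site 3)) a b))) →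
    (∀ x κ A : ℝ, 1 ≤ x → 0 < κ → x < A →
      (∃ C : ℝ, ∀ i : Fin 3, ∀ m : ℕ, 1 ≤ m → (bondPercolation (zdGraph 3) (criticalProbI 3)).real (AKN.edgeTwoArms i m) ≤ C * (m : ℝ) ^ (-κ)) →
      (0 < theta (zdGraph 3) 0 (criticalProbI 3) → ∃ δ : ℝ, 0 < δ ∧ ∀ᶠ u : ℕ in atTop, ∀ a ∈ box 3 u, ∀ b ∈ box 3 u,
          δ ≤ (bondPercolation (zdGraph 3) (criticalProbI 3)).real (openConnIn (↑(box 3 ⌈(u : ℝ) ^ x⌉₊) : Set (Site 3)) a b)) →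
      ∀ ζ : ℝ, ζ ≤ κ * A - 6 - 6 * x →
      (0 < theta (zdGraph 3) 0 (criticalProbI 3) → ∃ C : ℝ, ∀ᶠ u : ℕ in atTop,
          (bondPercolation (zdGraph 3) (criticalProbI 3)).real (@uniqZone 3 u ⌈(u : ℝ) ^ A⌉₊)ᶜ ≤ C * (u : ℝ) ^ (-ζ))) →
    (∃ A ζ : ℝ, 1 ≤ A ∧ 0 < ζ ∧
      (0 < theta (zdGraph 3) 0 (criticalProbI 3) → ∃ C : ℝ, ∀ᶠ u : ℕ in atTop,
          (bondPercolation (zdGraph 3) (criticalProbI 3)).real (@uniqZone 3 u ⌈(u : ℝ) ^ A⌉₊)ᶜ ≤ C * (u : ℝ) ^ (-ζ))) →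
    ∀ κ σ b : ℝ, 0 < κ → 0 < σ → 0 < b → 6 < κ * (1 + σ) → (6 + σ) / (κ * (1 + σ) - 6) < 1 + b →
    (∃ C : ℝ, ∀ i : Fin 3, ∀ m : ℕ, 1 ≤ m → (bondPercolation (zdGraph 3) (criticalProbI 3)).real (AKN.edgeTwoArms i m) ≤ C * (m : ℝ) ^ (-κ)) →
    (0 < theta (zdGraph 3) 0 (criticalProbI 3) → ∃ C : ℝ, ∀ u : ℕ, 1 ≤ u →
          (bondPercolation (zdGraph 3) (criticalProbI 3)).real {ω | ∀ x ∈ box 3 u, ω ∉ percolatesAt x} ≤ C * (u : ℝ) ^ (-σ)) →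
    (0 < theta (zdGraph 3) 0 (criticalProbI 3) → ∃ c : ℝ, 0 < c ∧ ∀ᶠ n : ℕ in atTop, ∀ y ∈ box 3 n,
        c ≤ (bondPercolation (zdGraph 3) (criticalProbI 3)).real (openConnIn (↑(box 3 ⌈(n : ℝ) ^ (1 + b)⌉₊) : Set (Site 3)) 0 y)) :=
  -- CLOSED: landed as `Theorems.stub_relayBootstrap` (p141088, wave 1)
  Summit.CriticalPhenomena.PercolationContinuityZ3.Theorems.stub_relayBootstrap

/-- The expanded `stub_relayBootstrap` IS the stub `Prop` (definitional consistency). [folklore] -/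
theorem stub_relayBootstrap' : Stubs.stub_relayBootstrap := stub_relayBootstrap

/-- The engine stub `Prop`s are the sorried engine theorems' statements (definitional consistency). [folklore] -/
theorem engineStubs_consistent :
    (Stubs.stub_lossyStep ↔
      ∀ x κ A : ℝ, 1 ≤ x → 0 < κ → x < A → Stubs.TwoArm κ → Stubs.PairLRO x →
        ∀ ζ : ℝ, ζ ≤ κ * A - 6 - 6 * x → Stubs.TwoClusterRate A ζ) ∧
    (Stubs.stub_relayChain ↔
      ∀ σ A ζ γ : ℝ, 0 < σ → 1 ≤ A → 0 < ζ → 1 / (1 + σ) < γ → 1 / (1 + ζ) < γ → γ ≤ 1 →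
        Stubs.OccRate σ → Stubs.TwoClusterRate A ζ → ∀ x : ℝ, max 1 (γ * A) < x → Stubs.PairLRO x) ∧
    (Stubs.stub_bootstrapInit ↔ ∃ A ζ : ℝ, 1 ≤ A ∧ 0 < ζ ∧ Stubs.TwoClusterRate A ζ) :=
  ⟨Iff.rfl, Iff.rfl, Iff.rfl⟩

/-- The spelled-out engine theorems ARE the stub `Prop`s. [folklore] -/
theorem stub_lossyStep' : Stubs.stub_lossyStep := stub_lossyStep

/-- The spelled-out engine theorems ARE the stub `Prop`s. [folklore] -/
theorem stub_relayChain' : Stubs.stub_relayChain := stub_relayChain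

/-- The spelled-out engine theorems ARE the stub `Prop`s. [folklore] -/
theorem stub_bootstrapInit' : Stubs.stub_bootstrapInit := stub_bootstrapInit

/-- **CERTIFICATE (consumed form modulo the two atoms).** `TwoArm κ ∧ OccRate σ ⇒ JumpBoxLRO b` whenever
`6 < κ(1+σ)` and `(6+σ)/(κ(1+σ)−6) < 1+b`, `b > 0`. [folklore] -/
theorem jumpBoxLRO_of_twoArm_of_occRate {κ σ b : ℝ} (hκ : 0 < κ) (hσ : 0 < σ) (hb : 0 < b)
    (h6 : 6 < κ * (1 + σ)) (hfix : (6 + σ) / (κ * (1 + σ) - 6) < 1 + b)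
    (hT : Stubs.TwoArm κ) (hO : Stubs.OccRate σ) : Stubs.JumpBoxLRO b :=
  stub_relayBootstrap' stub_relayChain' stub_lossyStep' stub_bootstrapInit' κ σ b hκ hσ hb h6 hfix hT hO

/-- **CERTIFICATE (the route from the atoms).** For real `a, b, κ, σ` with `0 < b`, `(1+b)(3−a) < 3`,
`6 < κ(1+σ)`, `(6+σ)/(κ(1+σ)−6) < 1+b`: the free-box power saving `S(a)` together with `TwoArm κ` and
`OccRate σ` gives `θ(p_c) = 0` on `ℤ³` — via `jumpBoxLRO_of_twoArm_of_occRate` and the landed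
`Consumed.raceLemma_of_jumpBoxLRO` (p125450). [folklore] -/
theorem percolationContinuityZ3_of_powerSaving_of_twoArm_of_occRate {a b κ σ : ℝ} (hb : 0 < b)
    (hab : (1 + b) * (3 - a) < 3) (hκ : 0 < κ) (hσ : 0 < σ) (h6 : 6 < κ * (1 + σ))
    (hfix : (6 + σ) / (κ * (1 + σ) - 6) < 1 + b)
    (hS : ∃ C : ℝ, ∀ R : ℕ, 1 ≤ R → ∑ y ∈ box 3 R,
      (bondPercolation (zdGraph 3) (criticalProbI 3)).real (openConnIn (↑(box 3 R) : Set (Site 3)) 0 y)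
        ≤ C * (R : ℝ) ^ (3 - a))
    (hT : Stubs.TwoArm κ) (hO : Stubs.OccRate σ) : _root_.PercolationContinuityZ3 :=
  NearLinearTwoClusterDecay.Consumed.raceLemma_of_jumpBoxLRO a b hb.le hab hS
    (jumpBoxLRO_of_twoArm_of_occRate hκ hσ hb h6 hfix hT hO)

/-- Instance: the filed race `(a, b) = (1/2, 1/6)` closes from `S(1/2)`, `TwoArm (9/5)` (κ̂ ≈ 1.79 measured,
kit j020669) and `OccRate 10`: `6 < 19.8`, `16/13.8 < 7/6`. [folklore] -/
example (hS : FreeSusceptibilityPowerSaving) (hT : Stubs.TwoArm (9 / 5)) (hO : Stubs.OccRate 10) :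
    _root_.PercolationContinuityZ3 := by
  have e : (3 : ℝ) - 1 / 2 = 5 / 2 := by norm_num
  refine percolationContinuityZ3_of_powerSaving_of_twoArm_of_occRate (a := 1 / 2) (b := 1 / 6)
    (by norm_num) (by norm_num) (by norm_num) (by norm_num) (by norm_num) (by norm_num) ?_ hT hO
  rw [e]; exact hS

/-- Instance: the route's second admissible race `(a, b) = (9/10, 2/5)` closes from `S(9/10)`,
`TwoArm (9/5)` and `OccRate 8`: `6 < 16.2`, `14/10.2 < 7/5`. [folklore] -/
example (hT : Stubs.TwoArm (9 / 5)) (hO : Stubs.OccRate 8)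
    (hS : ∃ C : ℝ, ∀ R : ℕ, 1 ≤ R → ∑ y ∈ box 3 R,
      (bondPercolation (zdGraph 3) (criticalProbI 3)).real (openConnIn (↑(box 3 R) : Set (Site 3)) 0 y)
        ≤ C * (R : ℝ) ^ (3 - (9 : ℝ) / 10)) : _root_.PercolationContinuityZ3 :=
  percolationContinuityZ3_of_powerSaving_of_twoArm_of_occRate (a := 9 / 10) (b := 2 / 5)
    (by norm_num) (by norm_num) (by norm_num) (by norm_num) (by norm_num) (by norm_num) hS hT hO

/-- Instance: with `κ > 1` and `σ(κ−1) ≥ 12 − κ` the fixed point is `≤ 1`, so ANY power saving `a > 0`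
completes the race (`b := a/6`): here `κ = 9/5`, `σ = 13`. [folklore] -/
example (hT : Stubs.TwoArm (9 / 5)) (hO : Stubs.OccRate 13) {a : ℝ} (ha : 0 < a)
    (hS : ∃ C : ℝ, ∀ R : ℕ, 1 ≤ R → ∑ y ∈ box 3 R,
      (bondPercolation (zdGraph 3) (criticalProbI 3)).real (openConnIn (↑(box 3 R) : Set (Site 3)) 0 y)
        ≤ C * (R : ℝ) ^ (3 - a)) : _root_.PercolationContinuityZ3 :=
  percolationContinuityZ3_of_powerSaving_of_twoArm_of_occRate (a := a) (b := a / 6)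
    (by positivity) (by nlinarith) (by norm_num) (by norm_num) (by norm_num)
    (by rw [div_lt_iff₀ (by norm_num)]; nlinarith) hS hT hO


/-! ## § Unconditional frontier (rev L7-c6): the world-free layer U₁ for bond `ℤ³`

Three FRONTIER stubs (certificates; not hypotheses of `NearLinearTwoClusterDecay_of`).  Vocabulary: `Stubs.TwoArm κ`
(above), the crux event at a general exponent (= `Negative.twoClusterEvt n ⌈n^A⌉₊`, `Negative.AtExponent A`). -/

namespace Stubs

/-- **Unconditional two-point lower bound at `p_c` inside boxes** (W1): `P_{p_c}(a ↔ b inside Λ_{2n}) ≥ c n^{-12}`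
for all `a, b ∈ Λ_n`, `n ≥ 1`. -/
def CritPairConnLower : Prop :=
  ∃ c : ℝ, 0 < c ∧ ∀ n : ℕ, 1 ≤ n → ∀ a ∈ box 3 n, ∀ b ∈ box 3 n,
    c * (n : ℝ) ^ (-(12 : ℝ)) ≤ Pc.real (openConnIn (↑(box 3 (2 * n)) : Set (Site 3)) a b)

/-- **Frontier stub `Prop` W1 (`critPairConnLower`).** -/
def stub_critPairConnLower : Prop := CritPairConnLower

/-- **Frontier stub `Prop` W2 (`critTwoArmImproved`): bond Cerf 2015 Thm 1.1 at `p_c`, qualitative.** -/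
def stub_critTwoArmImproved : Prop :=
  CritPairConnLower → ∃ κ : ℝ, 1 / 2 < κ ∧ TwoArm κ

/-- **Frontier stub `Prop` W3 (`critAspectOfTwoArm`): the unconditional lossy step.** -/
def stub_critAspectOfTwoArm : Prop :=
  CritPairConnLower → ∀ κ : ℝ, 0 < κ → TwoArm κ → ∀ A : ℝ, 1 < A → 24 < κ * A →
    Tendsto (fun n : ℕ => Pc.real
      {ω | ∃ x ∈ box 3 n, ∃ x' ∈ box 3 n, ∃ y ∈ innerBoundary (zdGraph 3) (box 3 ⌈(n : ℝ) ^ A⌉₊),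
        ∃ y' ∈ innerBoundary (zdGraph 3) (box 3 ⌈(n : ℝ) ^ A⌉₊),
          ω ∈ openConnIn ↑(box 3 ⌈(n : ℝ) ^ A⌉₊) x y ∧
          ω ∈ openConnIn ↑(box 3 ⌈(n : ℝ) ^ A⌉₊) x' y' ∧
          ω ∉ openConnIn ↑(box 3 ⌈(n : ℝ) ^ A⌉₊) x x'}) atTop (𝓝 0)

end Stubs

/-- **Frontier stub W1 (`critPairConnLower`) — the Duminil-Copin–Tassion / Kozma–Nachmias input at `p_c`, chained à la
Cerf Lemma 6.1 (bond, IN TREE: `Literature.Barriers.CriticalPhenomena.one_le_phi_criticalProbI`, `AKN.bconn_two_point_lower`).**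
`φ_{p_c}(Λ_m) ≥ 1` for every `m` (each `x ∈ ∂ⁱⁿΛ_m` has at most `6` outer neighbours, `|∂ⁱⁿΛ_m| ≤ 6(2m+1)²`) gives a
boundary point `b_m` with `P_{p_c}(0 ↔ b_m in Λ_m) ≥ (1/6)/(6(2m+1)²)`; `AKN.bconn_two_point_lower` (κ = 1/6) then gives
`P_{p_c}(a ↔ b in Λ_{2n}) ≥ p_c^5 (p_c ((1/6)/(6(2n+1)²))²)³ ≥ c n^{-12}` for `a, b ∈ Λ_n`, `n ≥ 1`
(`bconn = openConnVia (withinGraph ℤ³ Λ)` agrees with `openConnIn ↑Λ` on lattice configurations, a.s.). PROVABLE NOW. -/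
theorem stub_critPairConnLower :
    ∃ c : ℝ, 0 < c ∧ ∀ n : ℕ, 1 ≤ n → ∀ a ∈ box 3 n, ∀ b ∈ box 3 n,
      c * (n : ℝ) ^ (-(12 : ℝ)) ≤
        (bondPercolation (zdGraph 3) (criticalProbI 3)).real (openConnIn (↑(box 3 (2 * n)) : Set (Site 3)) a b) :=
  -- CLOSED: landed as `Theorems.stub_critPairConnLower` (p144917, wave 1)
  Summit.CriticalPhenomena.PercolationContinuityZ3.Theorems.stub_critPairConnLower

/-- **Frontier stub W2 (`critTwoArmImproved`) — bond Cerf 2015 Theorem 1.1 AT `p_c(ℤ³)`, unconditional, qualitative form.**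
Given the W1 input (in place of the `θ(p) > 0` connection bound of §10), Cerf's §8 inequality in polynomial form
(`Cerf2015BoxLRO16.cube_mul_real_edgeTwoArms_le` pattern, whose only use of `θ` is the box two-arms sum
`Σ_{z,z'∈Λ_k} P(twoArmsBox k ℓ z z') ≤ K k^{24} τ(ℓ−k−2)`, here obtained from Lemma 7.1 `AKN.real_twoArmsBox_mul_le`
divided by `c k^{-12}`) and one §9 iteration along the dyadic scales `n_s = (2·2^s+1)2^{55s} + 2^s`
(`real_edgeTwoArms_dyadic_le` pattern, AKN seed `AKN.exists_real_edgeTwoArms_le`) give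
`P_{p_c}(edgeTwoArms i (3n_s)) √n_s (√2)^s ≤ C`; monotonicity in the scale (`Cerf2015BoxLRO16.real_edgeTwoArms_anti`,
windows `exists_window`, `nseq_succ_le`) and `n_s ≤ 2^{56s+2}` turn this into `P_{p_c}(edgeTwoArms i m) ≤ C' m^{-κ}` for
some `κ > 1/2` (any `κ < 1/2 + 1/112`). PROVABLE NOW (copy-adapt, ~450 lines). -/
theorem stub_critTwoArmImproved :
    (∃ c : ℝ, 0 < c ∧ ∀ n : ℕ, 1 ≤ n → ∀ a ∈ box 3 n, ∀ b ∈ box 3 n,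
      c * (n : ℝ) ^ (-(12 : ℝ)) ≤
        (bondPercolation (zdGraph 3) (criticalProbI 3)).real (openConnIn (↑(box 3 (2 * n)) : Set (Site 3)) a b)) →
    ∃ κ : ℝ, 1 / 2 < κ ∧ ∃ C : ℝ, ∀ i : Fin 3, ∀ m : ℕ, 1 ≤ m →
      (bondPercolation (zdGraph 3) (criticalProbI 3)).real (AKN.edgeTwoArms i m) ≤ C * (m : ℝ) ^ (-κ) :=
  -- CLOSED: landed as `Theorems.stub_critTwoArmImproved` (p145559; aux `cube_mul_real_edgeTwoArms_le_crit` p145086; wave 1)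
  Summit.CriticalPhenomena.PercolationContinuityZ3.Theorems.stub_critTwoArmImproved

/-- **Frontier stub W3 (`critAspectOfTwoArm`) — the UNCONDITIONAL lossy step at `p_c` (Cerf 2015 Lemma 7.1 + Cor 7.2,
bond, IN TREE).**  With `N = ⌈n^A⌉₊`: the crux event for `(Λ_n, Λ_N)` is covered by `⋃_{z,z'∈Λ_n} twoArmsBox n (N−n) z z'`
(`Theorems.real_twoCluster_le_sum_twoArmsBox`, p139331's helper); Lemma 7.1 (`AKN.real_twoArmsBox_mul_le`, inner box `Λ_n`,
connection box `Λ_{2n}`, `ℓ = N − n`) divided by the W1 bound `c n^{-12}` and counted as in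
`NearLinearTwoClusterDecayLossyStep.real_compl_uniqZone_le_poly` gives
`P ≤ (2n+1)⁶ (1 + 6/p_c)(4n+3)⁶ · 3C (N−2n−2)^{−κ} / (c n^{-12}) ≤ K n^{24 − κA} → 0` when `κA > 24` (and `A > 1`, so that
`N ≥ 2n + 3` eventually; at `A ≤ 1` decay is FALSE, `Negative.not_atExponent_of_le_one`, while `TwoArm κ` with `κ > 24` is not
refutable in the tree — hence the explicit hypothesis `1 < A`, rev L7b-c6). PROVABLE NOW. -/
theorem stub_critAspectOfTwoArm :
    (∃ c : ℝ, 0 < c ∧ ∀ n : ℕ, 1 ≤ n → ∀ a ∈ box 3 n, ∀ b ∈ box 3 n,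
      c * (n : ℝ) ^ (-(12 : ℝ)) ≤
        (bondPercolation (zdGraph 3) (criticalProbI 3)).real (openConnIn (↑(box 3 (2 * n)) : Set (Site 3)) a b)) →
    ∀ κ : ℝ, 0 < κ →
    (∃ C : ℝ, ∀ i : Fin 3, ∀ m : ℕ, 1 ≤ m →
      (bondPercolation (zdGraph 3) (criticalProbI 3)).real (AKN.edgeTwoArms i m) ≤ C * (m : ℝ) ^ (-κ)) →
    ∀ A : ℝ, 1 < A → 24 < κ * A →
    Filter.Tendsto (fun n : ℕ => (bondPercolation (zdGraph 3) (criticalProbI 3)).real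
      {ω | ∃ x ∈ box 3 n, ∃ x' ∈ box 3 n, ∃ y ∈ innerBoundary (zdGraph 3) (box 3 ⌈(n : ℝ) ^ A⌉₊),
        ∃ y' ∈ innerBoundary (zdGraph 3) (box 3 ⌈(n : ℝ) ^ A⌉₊),
          ω ∈ openConnIn ↑(box 3 ⌈(n : ℝ) ^ A⌉₊) x y ∧
          ω ∈ openConnIn ↑(box 3 ⌈(n : ℝ) ^ A⌉₊) x' y' ∧
          ω ∉ openConnIn ↑(box 3 ⌈(n : ℝ) ^ A⌉₊) x x'}) Filter.atTop (nhds 0) :=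
  -- CLOSED: landed as `Theorems.stub_critAspectOfTwoArm` (p145039, wave 1)
  Summit.CriticalPhenomena.PercolationContinuityZ3.Theorems.stub_critAspectOfTwoArm

/-- **Frontier stub W4 (`superCritPairConnLower`, wave 2) — W1 at EVERY `p ≥ p_c`** (`φ_p(Λ_m) ≥ 1` for `p ≥ p_c`,
`Literature.Barriers.CriticalPhenomena.sum_sphere_real_openConnIn_ge`, + Cerf Lemma 6.1 chaining). CLOSED. -/
theorem stub_superCritPairConnLower :
    ∀ p : unitInterval, criticalProb (zdGraph 3) (0 : Site 3) ≤ (p : ℝ) →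
    ∃ c : ℝ, 0 < c ∧ ∀ n : ℕ, 1 ≤ n → ∀ a ∈ box 3 n, ∀ b ∈ box 3 n,
      c * (n : ℝ) ^ (-(12 : ℝ)) ≤
        (bondPercolation (zdGraph 3) p).real (openConnIn (↑(box 3 (2 * n)) : Set (Site 3)) a b) :=
  -- CLOSED: landed as `Theorems.stub_superCritPairConnLower` (p146251, wave 2)
  Summit.CriticalPhenomena.PercolationContinuityZ3.Theorems.stub_superCritPairConnLower

/-- **Frontier stub W5 (`aspectOfTwoArmBdry`, wave 2) — the lossy step at a general parameter with Cerf's BOUNDARY-pair count.**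
Both clusters cross `∂ⁱⁿΛ_n`, so the pair union bound runs over `(∂ⁱⁿΛ_n)²` (`≤ (6(2n+1)²)²`, exponent `4`) instead of `Λ_n²`
(exponent `6`): a pair bound `c n^{-e}` and a two-arms exponent `κ` give decay at every `A > 1` with `κA > 4 + 6 + e`. CLOSED. -/
theorem stub_aspectOfTwoArmBdry :
    ∀ p : unitInterval, 0 < (p : ℝ) → ∀ e : ℝ, 0 ≤ e →
    (∃ c : ℝ, 0 < c ∧ ∀ n : ℕ, 1 ≤ n → ∀ a ∈ box 3 n, ∀ b ∈ box 3 n,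
      c * (n : ℝ) ^ (-e) ≤
        (bondPercolation (zdGraph 3) p).real (openConnIn (↑(box 3 (2 * n)) : Set (Site 3)) a b)) →
    ∀ κ : ℝ, 0 < κ →
    (∃ C : ℝ, ∀ i : Fin 3, ∀ m : ℕ, 1 ≤ m →
      (bondPercolation (zdGraph 3) p).real (AKN.edgeTwoArms i m) ≤ C * (m : ℝ) ^ (-κ)) →
    ∀ A : ℝ, 1 < A → 10 + e < κ * A →
    Filter.Tendsto (fun n : ℕ => (bondPercolation (zdGraph 3) p).real
      {ω | ∃ x ∈ box 3 n, ∃ x' ∈ box 3 n, ∃ y ∈ innerBoundary (zdGraph 3) (box 3 ⌈(n : ℝ) ^ A⌉₊),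
        ∃ y' ∈ innerBoundary (zdGraph 3) (box 3 ⌈(n : ℝ) ^ A⌉₊),
          ω ∈ openConnIn ↑(box 3 ⌈(n : ℝ) ^ A⌉₊) x y ∧
          ω ∈ openConnIn ↑(box 3 ⌈(n : ℝ) ^ A⌉₊) x' y' ∧
          ω ∉ openConnIn ↑(box 3 ⌈(n : ℝ) ^ A⌉₊) x x'}) Filter.atTop (nhds 0) :=
  -- CLOSED: landed as `Theorems.stub_aspectOfTwoArmBdry` (p146647, wave 2)
  Summit.CriticalPhenomena.PercolationContinuityZ3.Theorems.stub_aspectOfTwoArmBdry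

/-- **CERTIFICATE U₁ at EVERY parameter (wave 2, LANDED p146707):** for every `p < 1` and every `A > 44` the crux event of
`(Λ_n, Λ_{⌈n^A⌉})` decays under `P_p` — `Theorems.NearLinearTwoClusterDecay.CritFrontier.twoClusterDecay_of_gt_44`. [folklore] -/
theorem twoClusterDecay_of_gt_44' (p : unitInterval) (hp1 : (p : ℝ) < 1) {A : ℝ} (hA : 44 < A) :
    Tendsto (fun n : ℕ => (bondPercolation (zdGraph 3) p).real
      {ω | ∃ x ∈ box 3 n, ∃ x' ∈ box 3 n, ∃ y ∈ innerBoundary (zdGraph 3) (box 3 ⌈(n : ℝ) ^ A⌉₊),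
        ∃ y' ∈ innerBoundary (zdGraph 3) (box 3 ⌈(n : ℝ) ^ A⌉₊),
          ω ∈ openConnIn ↑(box 3 ⌈(n : ℝ) ^ A⌉₊) x y ∧ ω ∈ openConnIn ↑(box 3 ⌈(n : ℝ) ^ A⌉₊) x' y' ∧
            ω ∉ openConnIn ↑(box 3 ⌈(n : ℝ) ^ A⌉₊) x x'}) atTop (𝓝 0) :=
  NearLinearTwoClusterDecay.CritFrontier.twoClusterDecay_of_gt_44 p hp1 hA

/-- **Status of the crux family after wave 2 (all LANDED, p146707)**: at `p_c` decay fails at every exponent `≤ 1`, holds at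
every exponent `≥ 44` and at some exponent `< 44`; the crux is the instance `7/6`. [folklore] -/
theorem atExponent_status_44 :
    (∀ A : ℝ, A ≤ 1 → ¬ NearLinearTwoClusterDecay.Negative.AtExponent A) ∧
    (∀ A : ℝ, 44 ≤ A → NearLinearTwoClusterDecay.Negative.AtExponent A) ∧
    (∃ A : ℝ, A < 44 ∧ NearLinearTwoClusterDecay.Negative.AtExponent A) ∧
    (Summit.CriticalPhenomena.PercolationContinuityZ3.Theses.PercShatteringRace.NearLinearTwoClusterDecay ↔
      NearLinearTwoClusterDecay.Negative.AtExponent ((7 : ℝ) / 6)) :=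
  NearLinearTwoClusterDecay.CritFrontier.atExponent_status_44

/-- The frontier stub `Prop`s are the sorried frontier theorems' statements (definitional consistency). [folklore] -/
theorem frontierStubs_consistent :
    (Stubs.stub_critPairConnLower ↔ Stubs.CritPairConnLower) ∧
    (Stubs.stub_critTwoArmImproved ↔ (Stubs.CritPairConnLower → ∃ κ : ℝ, 1 / 2 < κ ∧ Stubs.TwoArm κ)) ∧
    (Stubs.stub_critAspectOfTwoArm ↔ (Stubs.CritPairConnLower → ∀ κ : ℝ, 0 < κ → Stubs.TwoArm κ → ∀ A : ℝ,
      1 < A → 24 < κ * A → NearLinearTwoClusterDecay.Negative.AtExponent A)) :=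
  ⟨Iff.rfl, Iff.rfl, Iff.rfl⟩

/-- The spelled-out frontier theorems ARE the stub `Prop`s. [folklore] -/
theorem stub_critPairConnLower' : Stubs.stub_critPairConnLower := stub_critPairConnLower

/-- The spelled-out frontier theorems ARE the stub `Prop`s. [folklore] -/
theorem stub_critTwoArmImproved' : Stubs.stub_critTwoArmImproved := stub_critTwoArmImproved

/-- The spelled-out frontier theorems ARE the stub `Prop`s. [folklore] -/
theorem stub_critAspectOfTwoArm' : Stubs.stub_critAspectOfTwoArm := stub_critAspectOfTwoArm

/-- **CERTIFICATE U₁ (bond Cerf 2015 Thm 1.2 at `p_c(ℤ³)`, UNCONDITIONAL):** the crux family holds at every exponent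
`A > 48` — no hypothesis on the world (`θ(p_c) = 0` or `> 0`).  From W1, W3 and `TwoArm κ` for every `κ < 1/2` (AKN;
LANDED as `Theorems.NearLinearTwoClusterDecay.RelayBootstrap.twoArm_of_lt_half`, p142824 — taken here as the hypothesis
`hhalf` only because that module is not yet built on the farm at the time of registration; the Theorems-side certificate
imports it): given `A > 48` pick `κ = (1/2)(1/2 + 24/A) < 1/2` with `κA = A/4 + 12 > 24`. [folklore] -/
theorem critAtExponent_of_gt (h₁ : Stubs.stub_critPairConnLower) (h₃ : Stubs.stub_critAspectOfTwoArm)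
    (hhalf : ∀ κ : ℝ, κ < 1 / 2 → Stubs.TwoArm κ) {A : ℝ}
    (hA : 48 < A) : NearLinearTwoClusterDecay.Negative.AtExponent A := by
  have hA0 : 0 < A := by linarith
  set κ : ℝ := (1 / 2 + 24 / A) / 2 with hκ
  have h24A : 24 / A < 1 / 2 := by rw [div_lt_iff₀ hA0]; linarith
  have hκlt : κ < 1 / 2 := by rw [hκ]; linarith
  have hκ0 : 0 < κ := by rw [hκ]; positivity
  have hκA : 24 < κ * A := by
    have : κ * A = A / 4 + 12 := by rw [hκ]; field_simp; ring
    rw [this]; linarith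
  exact h₃ h₁ κ hκ0 (hhalf κ hκlt) A (by linarith) hκA

/-- The skeleton certificate instantiated with the LANDED AKN bound (`RelayBootstrap.twoArm_of_lt_half`, p142824) — this is
`Theorems.NearLinearTwoClusterDecay.CritFrontier.critAtExponent_of_gt_48` (p145562) re-derived inside the skeleton. [folklore] -/
theorem critAtExponent_of_gt' {A : ℝ} (hA : 48 < A) : NearLinearTwoClusterDecay.Negative.AtExponent A :=
  critAtExponent_of_gt stub_critPairConnLower' stub_critAspectOfTwoArm'
    (fun _ hκ => NearLinearTwoClusterDecay.RelayBootstrap.twoArm_of_lt_half hκ) hA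

/-- **CERTIFICATE (bond Cerf 2015 Thm 1.1 ⇒ strict improvement):** with W2 the threshold exponent of the crux family is
STRICTLY below `48`: `∃ A < 48, AtExponent A`. [folklore] -/
theorem critAtExponent_lt_48 (h₁ : Stubs.stub_critPairConnLower) (h₂ : Stubs.stub_critTwoArmImproved)
    (h₃ : Stubs.stub_critAspectOfTwoArm) : ∃ A : ℝ, A < 48 ∧ NearLinearTwoClusterDecay.Negative.AtExponent A := by
  obtain ⟨κ, hκ, hT⟩ := h₂ h₁
  have hκ0 : 0 < κ := by linarith
  -- `A = 24/κ + (48 - 24/κ)/2` lies strictly between `24/κ` and `48`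
  have h24 : 24 / κ < 48 := by rw [div_lt_iff₀ hκ0]; linarith
  have h0 : 0 < 24 / κ := by positivity
  refine ⟨(24 / κ + 48) / 2, by linarith, h₃ h₁ κ hκ0 hT _ (by linarith) ?_⟩
  have : κ * ((24 / κ + 48) / 2) = 12 + 24 * κ := by field_simp; ring
  rw [this]; linarith

/-- The strict improvement with the LANDED stubs — this is `Theorems.NearLinearTwoClusterDecay.CritFrontier.exists_critAtExponent_lt_48`
(p146064) re-derived inside the skeleton; the endpoint `A = 48` is `CritFrontier.critAtExponent_of_ge_48`. [folklore] -/
theorem critAtExponent_lt_48' : ∃ A : ℝ, A < 48 ∧ NearLinearTwoClusterDecay.Negative.AtExponent A :=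
  critAtExponent_lt_48 stub_critPairConnLower' stub_critTwoArmImproved' stub_critAspectOfTwoArm'

/-- **Status of the crux family (all LANDED)**: decay fails at every exponent `≤ 1`, holds at every exponent `≥ 48` and at
some exponent `< 48`, unconditionally; the crux is the instance `7/6`. [folklore] -/
theorem atExponent_status :
    (∀ A : ℝ, A ≤ 1 → ¬ NearLinearTwoClusterDecay.Negative.AtExponent A) ∧
    (∀ A : ℝ, 48 ≤ A → NearLinearTwoClusterDecay.Negative.AtExponent A) ∧
    (∃ A : ℝ, A < 48 ∧ NearLinearTwoClusterDecay.Negative.AtExponent A) ∧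
    (Summit.CriticalPhenomena.PercolationContinuityZ3.Theses.PercShatteringRace.NearLinearTwoClusterDecay ↔
      NearLinearTwoClusterDecay.Negative.AtExponent ((7 : ℝ) / 6)) :=
  NearLinearTwoClusterDecay.CritFrontier.atExponent_status'

/-- **Where the crux sits on this scale**: it is `AtExponent (7/6)`; the certificates give `AtExponent A` for `A > 48`
unconditionally (and for some `A < 48` with W2); `atExponent_mono` makes `{A ≥ 1 | AtExponent A}` an up-set, so the
open content of the crux is exactly the ASPECT REDUCTION `48 → 7/6` (child 1 in the jump world, child 2 in the null
world). [folklore] -/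
theorem crux_iff_atExponent_seven_sixths :
    Summit.CriticalPhenomena.PercolationContinuityZ3.Theses.PercShatteringRace.NearLinearTwoClusterDecay ↔
    NearLinearTwoClusterDecay.Negative.AtExponent ((7 : ℝ) / 6) := Iff.rfl

/-! ## § Pair-form frontier (rev L11-c8): the unconditional layer for CHILD 1 (`PairTwoArmsDecay`)

One FRONTIER stub (a certificate; not a hypothesis of `NearLinearTwoClusterDecay_of`).  Cerf's Lemma 7.1 for ONE deterministic
pair `(x, x') ∈ Λ_n²` needs no union bound over pairs (W3: `n⁶`; W5: boundary pairs `n⁴`), so a pair-connection bound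
`c n^{-e}` and a two-arms exponent `κ` give PAIR-form decay at every aspect exponent `A > 1` with `κA > 6 + e` (W5: `10 + e`).
With the landed W1 (`e = 12`) and W2 (`∃ κ > 1/2`): `PairAtExponent A` for every `A ≥ 36` unconditionally (union form: `44`,
`critAtExponent_of_ge_44`); child 1 is the instance `A = 7/6` (`childOne_iff_pairAtExponent`, `Iff.rfl`).  Exponent bookkeeping
inside the AKN/Cerf counting class (floor ≈ 5, AKN-count-budget-c6): it is the number the census of child 1 starts from, and says
nothing at `7/6`. -/

namespace Stubs

/-- **The PAIR-form crux family at aspect exponent `A`** (child 1 `PairTwoArmsDecay` = the instance `A = 7/6`): for every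
`ε > 0`, eventually in `n`, for ALL `x, x' ∈ Λ_n`, the probability that `x` and `x'` are each joined inside `Λ_N`,
`N = ⌈n^A⌉`, to `∂ⁱⁿΛ_N` but not to each other inside `Λ_N` is `≤ ε`. -/
def PairAtExponent (A : ℝ) : Prop :=
  ∀ ε : ℝ, 0 < ε → ∀ᶠ n : ℕ in Filter.atTop, ∀ x ∈ box 3 n, ∀ x' ∈ box 3 n,
    Pc.real {ω | ∃ y ∈ innerBoundary (zdGraph 3) (box 3 ⌈(n : ℝ) ^ A⌉₊),
      ∃ y' ∈ innerBoundary (zdGraph 3) (box 3 ⌈(n : ℝ) ^ A⌉₊),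
        ω ∈ openConnIn ↑(box 3 ⌈(n : ℝ) ^ A⌉₊) x y ∧
        ω ∈ openConnIn ↑(box 3 ⌈(n : ℝ) ^ A⌉₊) x' y' ∧
        ω ∉ openConnIn ↑(box 3 ⌈(n : ℝ) ^ A⌉₊) x x'} ≤ ε

/-- **Frontier stub `Prop` F1 (`pairAspectOfTwoArm`): the PAIR-form lossy step at a general parameter.** -/
def stub_pairAspectOfTwoArm : Prop :=
  ∀ p : unitInterval, 0 < (p : ℝ) → ∀ e : ℝ, 0 ≤ e →
    (∃ c : ℝ, 0 < c ∧ ∀ n : ℕ, 1 ≤ n → ∀ a ∈ box 3 n, ∀ b ∈ box 3 n,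
      c * (n : ℝ) ^ (-e) ≤
        (bondPercolation (zdGraph 3) p).real (openConnIn (↑(box 3 (2 * n)) : Set (Site 3)) a b)) →
    ∀ κ : ℝ, 0 < κ →
    (∃ C : ℝ, ∀ i : Fin 3, ∀ m : ℕ, 1 ≤ m →
      (bondPercolation (zdGraph 3) p).real (AKN.edgeTwoArms i m) ≤ C * (m : ℝ) ^ (-κ)) →
    ∀ A : ℝ, 1 < A → 6 + e < κ * A →
    ∀ ε : ℝ, 0 < ε → ∀ᶠ n : ℕ in Filter.atTop, ∀ x ∈ box 3 n, ∀ x' ∈ box 3 n,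
      (bondPercolation (zdGraph 3) p).real
        {ω | ∃ y ∈ innerBoundary (zdGraph 3) (box 3 ⌈(n : ℝ) ^ A⌉₊),
          ∃ y' ∈ innerBoundary (zdGraph 3) (box 3 ⌈(n : ℝ) ^ A⌉₊),
            ω ∈ openConnIn ↑(box 3 ⌈(n : ℝ) ^ A⌉₊) x y ∧
            ω ∈ openConnIn ↑(box 3 ⌈(n : ℝ) ^ A⌉₊) x' y' ∧
            ω ∉ openConnIn ↑(box 3 ⌈(n : ℝ) ^ A⌉₊) x x'} ≤ ε

end Stubs

/-- **Frontier stub F1 (`pairAspectOfTwoArm`) — the PAIR-form lossy step (Cerf 2015 Lemma 7.1, bond, IN TREE: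
`AKN.real_twoArmsBox_mul_le`), at a general parameter `p > 0`.**  For a FIXED pair `x, x' ∈ Λ_n` and `N = ⌈n^A⌉₊`,
on lattice configurations the pair event (both joined inside `Λ_N` to `∂ⁱⁿΛ_N`, not to each other inside `Λ_N`) lies in
`AKN.twoArmsBox n (N − n) x x'` (as in `NearLinearTwoClusterDecayAspectBdry.exists_bdry_pair_twoArmsBox`, without passing
to exit points); Lemma 7.1 with middle box `Λ_{2n}` divided by the pair bound `δ = c n^{-e}` (the per-pair inequality
`hpair` inside `NearLinearTwoClusterDecayAspectBdry.real_twoCluster_le_of_conn`) and the count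
`(1 + 3(4n+3)³/p)(4n+3)³ · 3C (N − 2n − 2)^{−κ} / (c n^{−e}) ≤ K n^{6 + e − κA}` (no pair sum: exponent `6 + e`, not
W5's `10 + e` or W3's `12 + e`) give a bound UNIFORM over the pair that tends to `0` when `κA > 6 + e` (and `A > 1`, so
that `2n + 3 ≤ N` eventually, `NearLinearTwoClusterDecayCritAspect.eventually_one_le_and_sixteen_mul_le`).
LANDED p151874 (324 lines, helpers `NearLinearTwoClusterDecayPairAspect.*`). [cite: Cerf2015, Lemma 7.1] -/
theorem stub_pairAspectOfTwoArm :
    ∀ p : unitInterval, 0 < (p : ℝ) → ∀ e : ℝ, 0 ≤ e →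
    (∃ c : ℝ, 0 < c ∧ ∀ n : ℕ, 1 ≤ n → ∀ a ∈ box 3 n, ∀ b ∈ box 3 n,
      c * (n : ℝ) ^ (-e) ≤
        (bondPercolation (zdGraph 3) p).real (openConnIn (↑(box 3 (2 * n)) : Set (Site 3)) a b)) →
    ∀ κ : ℝ, 0 < κ →
    (∃ C : ℝ, ∀ i : Fin 3, ∀ m : ℕ, 1 ≤ m →
      (bondPercolation (zdGraph 3) p).real (AKN.edgeTwoArms i m) ≤ C * (m : ℝ) ^ (-κ)) →
    ∀ A : ℝ, 1 < A → 6 + e < κ * A →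
    ∀ ε : ℝ, 0 < ε → ∀ᶠ n : ℕ in Filter.atTop, ∀ x ∈ box 3 n, ∀ x' ∈ box 3 n,
      (bondPercolation (zdGraph 3) p).real
        {ω | ∃ y ∈ innerBoundary (zdGraph 3) (box 3 ⌈(n : ℝ) ^ A⌉₊),
          ∃ y' ∈ innerBoundary (zdGraph 3) (box 3 ⌈(n : ℝ) ^ A⌉₊),
            ω ∈ openConnIn ↑(box 3 ⌈(n : ℝ) ^ A⌉₊) x y ∧
            ω ∈ openConnIn ↑(box 3 ⌈(n : ℝ) ^ A⌉₊) x' y' ∧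
            ω ∉ openConnIn ↑(box 3 ⌈(n : ℝ) ^ A⌉₊) x x'} ≤ ε :=
  -- CLOSED: landed as `Theorems.stub_pairAspectOfTwoArm` (p151874, wave 1, lead c8)
  Summit.CriticalPhenomena.PercolationContinuityZ3.Theorems.stub_pairAspectOfTwoArm

/-- The frontier stub `Prop` F1 is the (now closed) theorem's statement (definitional consistency). [folklore] -/
theorem pairFrontierStub_consistent :
    (Stubs.stub_pairAspectOfTwoArm ↔
      ∀ p : unitInterval, 0 < (p : ℝ) → ∀ e : ℝ, 0 ≤ e →
      (∃ c : ℝ, 0 < c ∧ ∀ n : ℕ, 1 ≤ n → ∀ a ∈ box 3 n, ∀ b ∈ box 3 n,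
        c * (n : ℝ) ^ (-e) ≤
          (bondPercolation (zdGraph 3) p).real (openConnIn (↑(box 3 (2 * n)) : Set (Site 3)) a b)) →
      ∀ κ : ℝ, 0 < κ →
      (∃ C : ℝ, ∀ i : Fin 3, ∀ m : ℕ, 1 ≤ m →
        (bondPercolation (zdGraph 3) p).real (AKN.edgeTwoArms i m) ≤ C * (m : ℝ) ^ (-κ)) →
      ∀ A : ℝ, 1 < A → 6 + e < κ * A →
      ∀ ε : ℝ, 0 < ε → ∀ᶠ n : ℕ in Filter.atTop, ∀ x ∈ box 3 n, ∀ x' ∈ box 3 n,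
        (bondPercolation (zdGraph 3) p).real
          {ω | ∃ y ∈ innerBoundary (zdGraph 3) (box 3 ⌈(n : ℝ) ^ A⌉₊),
            ∃ y' ∈ innerBoundary (zdGraph 3) (box 3 ⌈(n : ℝ) ^ A⌉₊),
              ω ∈ openConnIn ↑(box 3 ⌈(n : ℝ) ^ A⌉₊) x y ∧
              ω ∈ openConnIn ↑(box 3 ⌈(n : ℝ) ^ A⌉₊) x' y' ∧
              ω ∉ openConnIn ↑(box 3 ⌈(n : ℝ) ^ A⌉₊) x x'} ≤ ε) ∧
    (Stubs.PairTwoArmsDecay ↔ Stubs.PairAtExponent ((7 : ℝ) / 6)) :=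
  ⟨Iff.rfl, Iff.rfl⟩

/-- The spelled-out frontier theorem IS the stub `Prop` F1. [folklore] -/
theorem stub_pairAspectOfTwoArm' : Stubs.stub_pairAspectOfTwoArm := stub_pairAspectOfTwoArm

/-- **Child 1 is the instance `A = 7/6` of the pair-form family.** [folklore] -/
theorem childOne_iff_pairAtExponent : Stubs.PairTwoArmsDecay ↔ Stubs.PairAtExponent ((7 : ℝ) / 6) := Iff.rfl

/-- **The union form dominates the pair form**: `AtExponent A → PairAtExponent A` (a fixed pair of `Λ_n` is an instance of
the existential pair of `twoClusterEvt n N`). [folklore] -/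
theorem pairAtExponent_of_atExponent {A : ℝ} (h : NearLinearTwoClusterDecay.Negative.AtExponent A) :
    Stubs.PairAtExponent A := by
  intro ε hε
  have hev : ∀ᶠ n : ℕ in atTop, NearLinearTwoClusterDecay.Negative.critBond.real
      (NearLinearTwoClusterDecay.Negative.twoClusterEvt n ⌈(n : ℝ) ^ A⌉₊) < ε := (tendsto_order.1 h).2 ε hε
  filter_upwards [hev] with n hn x hx x' hx'
  refine le_trans (measureReal_mono ?_ (measure_ne_top _ _)) hn.le
  intro ω hω
  obtain ⟨y, hy, y', hy', h1, h2, h3⟩ := hω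
  exact ⟨x, hx, x', hx', y, hy, y', hy', h1, h2, h3⟩

/-- **CERTIFICATE (pair form, UNCONDITIONAL): `PairAtExponent A` for every `A > 36`** from F1, W1 (`e = 12`) and the AKN
exponent `κ = (1/2 + 18/A)/2 < 1/2` (`κA = A/4 + 9 > 18 = 6 + 12`). [folklore] -/
theorem critPairAtExponent_of_gt (hF : Stubs.stub_pairAspectOfTwoArm) (h₁ : Stubs.stub_critPairConnLower)
    (hhalf : ∀ κ : ℝ, κ < 1 / 2 → Stubs.TwoArm κ) {A : ℝ} (hA : 36 < A) : Stubs.PairAtExponent A := by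
  have hp0 : 0 < ((criticalProbI 3 : unitInterval) : ℝ) := by
    rw [coe_criticalProbI]; exact (Grimmett1999_criticalProb_pos_lt_one_holds 3 (by norm_num)).1
  have hA0 : 0 < A := by linarith
  set κ : ℝ := (1 / 2 + 18 / A) / 2 with hκ
  have h18A : 18 / A < 1 / 2 := by rw [div_lt_iff₀ hA0]; linarith
  have hκlt : κ < 1 / 2 := by rw [hκ]; linarith
  have hκ0 : 0 < κ := by rw [hκ]; positivity
  have hκA : 6 + 12 < κ * A := by
    have : κ * A = A / 4 + 9 := by rw [hκ]; field_simp; ring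
    rw [this]; linarith
  exact hF (criticalProbI 3) hp0 12 (by norm_num) h₁ κ hκ0 (hhalf κ hκlt) A (by linarith) hκA

/-- **CERTIFICATE (pair form, with bond Cerf Thm 1.1 at `p_c`, W2): `PairAtExponent A` for every `A ≥ 36`** —
`κ > 1/2` gives `κA ≥ 36κ > 18`; no monotonicity in `A` is needed. [folklore] -/
theorem critPairAtExponent_of_ge (hF : Stubs.stub_pairAspectOfTwoArm) (h₁ : Stubs.stub_critPairConnLower)
    (h₂ : Stubs.stub_critTwoArmImproved) {A : ℝ} (hA : 36 ≤ A) : Stubs.PairAtExponent A := by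
  have hp0 : 0 < ((criticalProbI 3 : unitInterval) : ℝ) := by
    rw [coe_criticalProbI]; exact (Grimmett1999_criticalProb_pos_lt_one_holds 3 (by norm_num)).1
  obtain ⟨κ, hκ, hT⟩ := h₂ h₁
  have hκ0 : 0 < κ := by linarith
  have hκA : 6 + 12 < κ * A := by nlinarith
  exact hF (criticalProbI 3) hp0 12 (by norm_num) h₁ κ hκ0 hT A (by linarith) hκA

/-- The pair-form certificate with the LANDED inputs (F1 p151874, W1 p144917, AKN `RelayBootstrap.twoArm_of_lt_half` p142824):
kernel-closed. [folklore] -/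
theorem critPairAtExponent_of_gt' {A : ℝ} (hA : 36 < A) : Stubs.PairAtExponent A :=
  critPairAtExponent_of_gt stub_pairAspectOfTwoArm' stub_critPairConnLower'
    (fun _ hκ => NearLinearTwoClusterDecay.RelayBootstrap.twoArm_of_lt_half hκ) hA

/-- The endpoint with the LANDED F1 (p151874) and W2 (p145559): kernel-closed. [folklore] -/
theorem critPairAtExponent_of_ge' {A : ℝ} (hA : 36 ≤ A) : Stubs.PairAtExponent A :=
  critPairAtExponent_of_ge stub_pairAspectOfTwoArm' stub_critPairConnLower' stub_critTwoArmImproved' hA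

/-- **Status of the PAIR-form family (all LANDED)**: decay at every exponent `≥ 36` (pair count saved: union form `44`),
and child 1 is the instance `7/6`; the open content of child 1 is the aspect reduction `36 → 7/6` (jump world). [folklore] -/
theorem pairAtExponent_status :
    (∀ A : ℝ, 36 ≤ A → Stubs.PairAtExponent A) ∧
    (∀ A : ℝ, 44 ≤ A → NearLinearTwoClusterDecay.Negative.AtExponent A) ∧
    (Stubs.PairTwoArmsDecay ↔ Stubs.PairAtExponent ((7 : ℝ) / 6)) :=
  ⟨fun _ hA => critPairAtExponent_of_ge' hA, fun _ hA => NearLinearTwoClusterDecay.CritFrontier.critAtExponent_of_ge_44 hA,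
    Iff.rfl⟩


/-! ## § Averaged profile (rev L13-c10): child 1 ⟺ its averaged form (certificate LANDED, p156545) -/

namespace Stubs

/-- The AVERAGED pair form: for every `x ∈ Λ(n)` the expected number of bad partners `w ∈ Λ(n)` of `x`
(both reach `∂ⁱⁿΛ(m)` inside `Λ(m)`, not joined inside `Λ(m)`, `m = ⌈n^{7/6}⌉`) is `≤ ε|Λ(n)|`. -/
def AvgPairTwoArmsDecay : Prop :=
    ∀ ε : ℝ, 0 < ε → ∀ᶠ n : ℕ in Filter.atTop, ∀ x ∈ box 3 n,
      ∑ w ∈ box 3 n, (bondPercolation (zdGraph 3) (criticalProbI 3)).real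
        {ω | ∃ y ∈ innerBoundary (zdGraph 3) (box 3 ⌈(n : ℝ) ^ ((7 : ℝ) / 6)⌉₊),
          ∃ y' ∈ innerBoundary (zdGraph 3) (box 3 ⌈(n : ℝ) ^ ((7 : ℝ) / 6)⌉₊),
            ω ∈ openConnIn ↑(box 3 ⌈(n : ℝ) ^ ((7 : ℝ) / 6)⌉₊) x y ∧
            ω ∈ openConnIn ↑(box 3 ⌈(n : ℝ) ^ ((7 : ℝ) / 6)⌉₊) w y' ∧
            ω ∉ openConnIn ↑(box 3 ⌈(n : ℝ) ^ ((7 : ℝ) / 6)⌉₊) x w} ≤ ε * (box 3 n).card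

end Stubs

/-- **Child 1 ⟺ its averaged form**, unconditionally (landed `Theorems.pairTwoArmsDecay_iff_avgPairDecay`, p156545). [folklore] -/
theorem childOne_iff_avgPair : Stubs.PairTwoArmsDecay ↔ Stubs.AvgPairTwoArmsDecay :=
  Summit.CriticalPhenomena.PercolationContinuityZ3.Theorems.pairTwoArmsDecay_iff_avgPairDecay

/-- Hence the open stub 1b is equivalently `0 < θ(p_c) → AvgPairTwoArmsDecay` (its `θ(p_c) = 0` half is automatic either way). [folklore] -/
theorem stub_pairDecayJumpWorld_iff_avg :
    Stubs.stub_pairDecayJumpWorld ↔ (0 < theta (zdGraph 3) 0 (criticalProbI 3) → Stubs.AvgPairTwoArmsDecay) :=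
  ⟨fun h hθ => childOne_iff_avgPair.1 (h hθ), fun h hθ => childOne_iff_avgPair.2 (h hθ)⟩

/-- The composition with the averaged child 1 (landed glue variant
`Theorems.nearLinearTwoClusterDecay_of_avgPairDecay_of_longArmsAreDense`). [folklore] -/
theorem NearLinearTwoClusterDecay_of_avgPair (h₁ : Stubs.AvgPairTwoArmsDecay) (h₂ : Stubs.stub_longArmsAreDense) :
    Summit.CriticalPhenomena.PercolationContinuityZ3.Theses.PercShatteringRace.NearLinearTwoClusterDecay :=
  Summit.CriticalPhenomena.PercolationContinuityZ3.Theorems.nearLinearTwoClusterDecay_of_avgPairDecay_of_longArmsAreDense h₁ h₂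


/-! ## § Point-to-point frontier (rev L14-c13): van den Berg–Don 2020 for bond `ℤ³` at `p_c`

Exponent bookkeeping for the record (STRATEGY-CENSUS s1 §1(h)/§6: "van den Berg–Don would move c6's frontier 44 → 38;
not progress toward 7/6" — recorded as such).  The pointwise two-point input of the lossy steps W5/F1 improves from
Cerf's `e = 2d(d-1) = 12` (W1, Lemma 6.1) to van den Berg–Don's `e = d² = 9` (arXiv:1912.10964, Thm 1 / Cor 2:
`P_{p_c}(x ↔ y in Λ_{9n}) ≥ c n^{-9}` on `Λ_n²`; site percolation in print, the proof is verbatim for bond).  Its proof is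
registered as stubs: V1 `stub_vdbdGoodPath` (Hammersley–Duminil-Copin–Tassion `φ_{p_c}(S) ≥ 1` for a GENERAL finite
`S ∋ 0`, IN TREE `one_le_phi_criticalProbI`, grown from `{0}` ⇒ a lattice path of GOOD points
`P_{p_c}(0 ↔ v in Λ_n) ≥ 1/(6|Λ_n|)` from `0` to `∂ⁱⁿΛ_n`; Lemma 8(b) of the paper), V2 `stub_vdbdAxisPaths`
(symmetrisation: for each axis a good path across `Λ_n` from `x_i = -n` to `x_i = n`; Lemmas 8(a), 10), V3a
`stub_vdbdCubeSurj` (Poincaré–Miranda surjectivity of the cube from the tree's Brouwer theorem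
`Literature/Analysis/Convex/SchauderFixedPoint`, Lemma 18), V4 `stub_vdbdChain` (Harris–FKG chaining of three good
points and one edge inside `Λ_{4n}`, Lemma 16), V6 `stub_aspectOfTwoArmBdryWide` (W5 with connection box `Λ_{9n}`,
Cerf Remark (ii)); the covering step V3b (`Stubs.VdbdCovering`: polylines, the map `g` of Definition 13 for `d = 3`,
sign bookkeeping of Lemma 14) and the assembly `critPairConnLower9_of` (symmetry + translation + constants) are the
lead's.  Certificates below: `AtExponent A` for every `A > 38` (AKN `κ < 1/2`) and every `A ≥ 38` (W2), against `44`
(p146707).  The two children stay OPEN/STUCK; the composition `NearLinearTwoClusterDecay_of` is untouched. -/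

namespace Stubs

/-- Goodness threshold `q_n = 1/(6|Λ_n|)` of van den Berg–Don's Definition 7 (with DCT's `2d = 6`). -/
def vdbdQ (n : ℕ) : ℝ := (1 : ℝ) / (6 * ((box 3 n).card : ℝ))

/-- **Frontier stub `Prop` V1 (`vdbdGoodPath`)**: a lattice path of good points from `0` to `∂ⁱⁿΛ_n` inside `Λ_n`. -/
def stub_vdbdGoodPath : Prop :=
  ∀ n : ℕ, ∃ k : ℕ, ∃ f : ℕ → Site 3, f 0 = 0 ∧ f k ∈ innerBoundary (zdGraph 3) (box 3 n) ∧
    (∀ j < k, (zdGraph 3).Adj (f j) (f (j + 1))) ∧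
    ∀ j ≤ k, f j ∈ box 3 n ∧
      (1 : ℝ) / (6 * ((box 3 n).card : ℝ)) ≤ Pc.real (openConnIn (↑(box 3 n) : Set (Site 3)) 0 (f j))

/-- **Axis-crossing good paths** (conclusion of V2): for every axis `i` a sequence of good points of `Λ_n` with
`ℓ¹`-steps `≤ 1` from the face `x_i = -n` to the face `x_i = n`. -/
def VdbdAxisPaths : Prop :=
  ∀ n : ℕ, ∀ i : Fin 3, ∃ k : ℕ, ∃ g : ℕ → Site 3, g 0 i = -(n : ℤ) ∧ g k i = n ∧
    (∀ j < k, ∑ c, |g j c - g (j + 1) c| ≤ 1) ∧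
    ∀ j ≤ k, g j ∈ box 3 n ∧
      (1 : ℝ) / (6 * ((box 3 n).card : ℝ)) ≤ Pc.real (openConnIn (↑(box 3 n) : Set (Site 3)) 0 (g j))

/-- **Frontier stub `Prop` V2 (`vdbdAxisPaths`)**: V1 ⇒ axis-crossing good paths (reflections and coordinate
permutations preserve goodness, `real_openConnIn_signedPerm_box`). -/
def stub_vdbdAxisPaths : Prop := stub_vdbdGoodPath → VdbdAxisPaths

/-- **Frontier stub `Prop` V3a (`vdbdCubeSurj`)**: Poincaré–Miranda surjectivity — a continuous self-map of
coordinates on the unit cube of `ℝ^d` with `f_i ≤ lo_i` on `{x_i = 0}` and `f_i ≥ hi_i` on `{x_i = 1}` attains every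
value in `[lo, hi]` (van den Berg–Don Lemma 18, Schrijver; from Brouwer). -/
def stub_vdbdCubeSurj : Prop :=
  ∀ (d : ℕ) (f : (Fin d → ℝ) → (Fin d → ℝ)) (lo hi : Fin d → ℝ),
    ContinuousOn f (Set.Icc 0 1) →
    (∀ x ∈ Set.Icc (0 : Fin d → ℝ) 1, ∀ i, x i = 0 → f x i ≤ lo i) →
    (∀ x ∈ Set.Icc (0 : Fin d → ℝ) 1, ∀ i, x i = 1 → hi i ≤ f x i) →
    ∀ a : Fin d → ℝ, lo ≤ a → a ≤ hi → ∃ x ∈ Set.Icc (0 : Fin d → ℝ) 1, f x = a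

/-- **Covering step V3b (lead's; van den Berg–Don Lemma 14 for `d = 3`)**: given three axis-crossing sequences in
`Λ_n` with `ℓ¹`-steps `≤ 1`, every lattice point of `[0,n]³` is within `ℓ¹`-distance `1` of a sum of three signed
points of the sequences. Purely deterministic. -/
def VdbdCovering : Prop :=
  ∀ (n : ℕ) (L : Fin 3 → ℕ) (g : Fin 3 → ℕ → Site 3),
    (∀ i, g i 0 i = -(n : ℤ)) → (∀ i, g i (L i) i = n) →
    (∀ i, ∀ j < L i, ∑ c, |g i j c - g i (j + 1) c| ≤ 1) →
    (∀ i, ∀ j ≤ L i, g i j ∈ box 3 n) →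
    ∀ x : Site 3, (∀ c, 0 ≤ x c ∧ x c ≤ n) →
      ∃ j : Fin 3 → ℕ, (∀ i, j i ≤ L i) ∧ ∃ ε : Fin 3 → Fin 3 → ℤˣ,
        ∑ c, |x c - ∑ i, (ε i c : ℤ) * g i (j i) c| ≤ 1

/-- **Frontier stub `Prop` V4 (`vdbdChain`)**: Harris–FKG chaining — three good points `z₁, z₂, z₃` of `Λ_n` whose
sum is within one lattice step of `x` give `P_{p_c}(0 ↔ x in Λ_{4n}) ≥ p_c q_n³` (van den Berg–Don Lemma 16). -/
def stub_vdbdChain : Prop :=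
  ∀ n : ℕ, 1 ≤ n → ∀ x : Site 3, ∀ z : Fin 3 → Site 3,
    (∀ i, z i ∈ box 3 n) →
    (∀ i, (1 : ℝ) / (6 * ((box 3 n).card : ℝ)) ≤ Pc.real (openConnIn (↑(box 3 n) : Set (Site 3)) 0 (z i))) →
    ∑ c, |x c - ∑ i, z i c| ≤ 1 →
    ((criticalProbI 3 : unitInterval) : ℝ) * ((1 : ℝ) / (6 * ((box 3 n).card : ℝ))) ^ 3 ≤
      Pc.real (openConnIn (↑(box 3 (4 * n)) : Set (Site 3)) 0 x)

/-- **van den Berg–Don 2020, Corollary 2, bond `ℤ³`** (the target of this §): `P_{p_c}(a ↔ b in Λ_{9n}) ≥ c n^{-9}`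
for all `a, b ∈ Λ_n`, `n ≥ 1`. -/
def CritPairConnLower9 : Prop :=
  ∃ c : ℝ, 0 < c ∧ ∀ n : ℕ, 1 ≤ n → ∀ a ∈ box 3 n, ∀ b ∈ box 3 n,
    c * (n : ℝ) ^ (-(9 : ℝ)) ≤ Pc.real (openConnIn (↑(box 3 (9 * n)) : Set (Site 3)) a b)

/-- **Frontier stub `Prop` V6 (`aspectOfTwoArmBdryWide`)**: W5 with the pair bound taken inside the connection box
`Λ_{9n}` (Cerf 2015 Lemma 7.1 with `k = 8n`; Remark (ii) of van den Berg–Don). -/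
def stub_aspectOfTwoArmBdryWide : Prop :=
  ∀ p : unitInterval, 0 < (p : ℝ) → ∀ e : ℝ, 0 ≤ e →
    (∃ c : ℝ, 0 < c ∧ ∀ n : ℕ, 1 ≤ n → ∀ a ∈ box 3 n, ∀ b ∈ box 3 n,
      c * (n : ℝ) ^ (-e) ≤
        (bondPercolation (zdGraph 3) p).real (openConnIn (↑(box 3 (9 * n)) : Set (Site 3)) a b)) →
    ∀ κ : ℝ, 0 < κ →
    (∃ C : ℝ, ∀ i : Fin 3, ∀ m : ℕ, 1 ≤ m →
      (bondPercolation (zdGraph 3) p).real (AKN.edgeTwoArms i m) ≤ C * (m : ℝ) ^ (-κ)) →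
    ∀ A : ℝ, 1 < A → 10 + e < κ * A →
    Tendsto (fun n : ℕ => (bondPercolation (zdGraph 3) p).real
      {ω | ∃ x ∈ box 3 n, ∃ x' ∈ box 3 n, ∃ y ∈ innerBoundary (zdGraph 3) (box 3 ⌈(n : ℝ) ^ A⌉₊),
        ∃ y' ∈ innerBoundary (zdGraph 3) (box 3 ⌈(n : ℝ) ^ A⌉₊),
          ω ∈ openConnIn ↑(box 3 ⌈(n : ℝ) ^ A⌉₊) x y ∧
          ω ∈ openConnIn ↑(box 3 ⌈(n : ℝ) ^ A⌉₊) x' y' ∧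
          ω ∉ openConnIn ↑(box 3 ⌈(n : ℝ) ^ A⌉₊) x x'}) atTop (𝓝 0)

end Stubs

/-- **Frontier stub V1 (`vdbdGoodPath`) — van den Berg–Don 2020 Lemma 8(b), bond `ℤ³` at `p_c`.**  Call `v ∈ Λ_n` GOOD if
`P_{p_c}(0 ↔ v in Λ_n) ≥ 1/(6|Λ_n|)`.  Let `Γ ⊆ Λ_n` be the set of points reachable from `0` by a lattice path of good
points of `Λ_n` (`0` is good).  If `Γ ∩ ∂ⁱⁿΛ_n = ∅`: `φ_{p_c}(Γ) = p_c Σ_{x ∈ Γ} Σ_{y ∼ x, y ∉ Γ} P(0 ↔ x in Γ) ≥ 1`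
(`Literature.Barriers.CriticalPhenomena.one_le_phi_criticalProbI`, `DCT16.phi_def`), at most `6|Γ| ≤ 6|Λ_n|` terms, so some
`x ∈ Γ`, `y ∼ x`, `y ∉ Γ` has `P(0 ↔ x in Γ) ≥ 1/(p_c·6|Λ_n|)`; `y ∈ Λ_n` (as `x ∉ ∂ⁱⁿΛ_n`) and
`P(0 ↔ y in Λ_n) ≥ P({0 ↔ x in Γ} ∩ {xy open}) ≥ p_c · P(0 ↔ x in Γ) ≥ 1/(6|Λ_n|)` (Harris–FKG `harris_fkg_holds`, or
independence), so `y` is good and reachable: contradiction.  Hence a good path reaches `∂ⁱⁿΛ_n`; read it off a `Walk`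
(`getVert`). CLOSED p163572. [cite: VandenbergDon2020, Lemma 8] -/
theorem stub_vdbdGoodPath :
    ∀ n : ℕ, ∃ k : ℕ, ∃ f : ℕ → Site 3, f 0 = 0 ∧ f k ∈ innerBoundary (zdGraph 3) (box 3 n) ∧
      (∀ j < k, (zdGraph 3).Adj (f j) (f (j + 1))) ∧
      ∀ j ≤ k, f j ∈ box 3 n ∧
        (1 : ℝ) / (6 * ((box 3 n).card : ℝ)) ≤
          (bondPercolation (zdGraph 3) (criticalProbI 3)).real (openConnIn (↑(box 3 n) : Set (Site 3)) 0 (f j)) :=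
  -- CLOSED: landed as `Theorems.stub_vdbdGoodPath` (p163572, wave 1, lead c13)
  Summit.CriticalPhenomena.PercolationContinuityZ3.Theorems.stub_vdbdGoodPath

/-- **Frontier stub V2 (`vdbdAxisPaths`) — van den Berg–Don 2020 Lemmas 8(a), 10.**  From V1's good path `f` from `0`
to `v ∈ ∂ⁱⁿΛ_n` (some coordinate `i₀` with `|v_{i₀}| = n`, `mem_innerBoundary_box`): coordinatewise absolute values keep
lattice adjacency, membership in `Λ_n` and goodness (`real_openConnIn_signedPerm_box` with `π = 1`); a coordinate
permutation moving `i₀` to the prescribed axis `i` keeps all three (same lemma, `signedPerm_mem_box_iff`); finally the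
reflected path `j ↦ ρ_i(f(k-j))` (`ρ_i` = sign change of coordinate `i`) followed by `f` runs from `x_i = -n` through `0`
to `x_i = n` with `ℓ¹`-steps `≤ 1` (the junction step at `0` has length `0`). CLOSED p163280. [cite: VandenbergDon2020, Lemma 10] -/
theorem stub_vdbdAxisPaths :
    (∀ n : ℕ, ∃ k : ℕ, ∃ f : ℕ → Site 3, f 0 = 0 ∧ f k ∈ innerBoundary (zdGraph 3) (box 3 n) ∧
      (∀ j < k, (zdGraph 3).Adj (f j) (f (j + 1))) ∧
      ∀ j ≤ k, f j ∈ box 3 n ∧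
        (1 : ℝ) / (6 * ((box 3 n).card : ℝ)) ≤
          (bondPercolation (zdGraph 3) (criticalProbI 3)).real (openConnIn (↑(box 3 n) : Set (Site 3)) 0 (f j))) →
    ∀ n : ℕ, ∀ i : Fin 3, ∃ k : ℕ, ∃ g : ℕ → Site 3, g 0 i = -(n : ℤ) ∧ g k i = n ∧
      (∀ j < k, ∑ c, |g j c - g (j + 1) c| ≤ 1) ∧
      ∀ j ≤ k, g j ∈ box 3 n ∧
        (1 : ℝ) / (6 * ((box 3 n).card : ℝ)) ≤
          (bondPercolation (zdGraph 3) (criticalProbI 3)).real (openConnIn (↑(box 3 n) : Set (Site 3)) 0 (g j)) :=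
  -- CLOSED: landed as `Theorems.stub_vdbdAxisPaths` (p163280, wave 1, lead c13)
  Summit.CriticalPhenomena.PercolationContinuityZ3.Theorems.stub_vdbdAxisPaths

/-- **Frontier stub V3a (`vdbdCubeSurj`) — Poincaré–Miranda surjectivity (van den Berg–Don 2020 Lemma 18, L. Schrijver).**
For `f` continuous on the unit cube `[0,1]^d ⊆ ℝ^d` with `f(x)_i ≤ lo_i` whenever `x_i = 0` and `f(x)_i ≥ hi_i` whenever
`x_i = 1`, every `a ∈ [lo, hi]` is a value of `f` on the cube.  Proof from the tree's Brouwer theorem for compact convex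
sets (`Literature/Analysis/Convex/SchauderFixedPoint.lean`, `exists_fixedPoint_of_isCompact_convex`, `K = Set.Icc 0 1`,
`E = ⊤`): the map `T(x)_i = max 0 (min 1 (x_i - (f(x)_i - a_i)))` is continuous `K → K`; at a fixed point `x`,
`0 < x_i < 1` forces `f(x)_i = a_i`, `x_i = 0` forces `f(x)_i ≥ a_i ≥ lo_i ≥ f(x)_i`, `x_i = 1` forces
`f(x)_i ≤ a_i ≤ hi_i ≤ f(x)_i`. CLOSED p163009. [cite: VandenbergDon2020, Lemma 18] -/
theorem stub_vdbdCubeSurj :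
    ∀ (d : ℕ) (f : (Fin d → ℝ) → (Fin d → ℝ)) (lo hi : Fin d → ℝ),
      ContinuousOn f (Set.Icc 0 1) →
      (∀ x ∈ Set.Icc (0 : Fin d → ℝ) 1, ∀ i, x i = 0 → f x i ≤ lo i) →
      (∀ x ∈ Set.Icc (0 : Fin d → ℝ) 1, ∀ i, x i = 1 → hi i ≤ f x i) →
      ∀ a : Fin d → ℝ, lo ≤ a → a ≤ hi → ∃ x ∈ Set.Icc (0 : Fin d → ℝ) 1, f x = a :=
  -- CLOSED: landed as `Theorems.stub_vdbdCubeSurj` (p163009, wave 1, lead c13)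
  Summit.CriticalPhenomena.PercolationContinuityZ3.Theorems.stub_vdbdCubeSurj

/-- **Frontier stub V4 (`vdbdChain`) — van den Berg–Don 2020 Lemma 16, bond `ℤ³`.**  For `n ≥ 1`, good points
`z₁, z₂, z₃ ∈ Λ_n` and `x` within `ℓ¹`-distance `1` of `z₁ + z₂ + z₃`: the increasing events `{0 ↔ z₁ in Λ_n}`,
`{z₁ ↔ z₁+z₂ in z₁+Λ_n}`, `{z₁+z₂ ↔ z₁+z₂+z₃ in z₁+z₂+Λ_n}` (probabilities `≥ q_n` by translation invariance,
`real_openConnIn_shift_box`) and, if `x ≠ z₁+z₂+z₃`, `{the edge {z₁+z₂+z₃, x} is open}` (probability `p_c`; the two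
points are lattice neighbours) are all contained in boxes inside `Λ_{3n+1} ⊆ Λ_{4n}`; Harris–FKG (`harris_fkg_holds`)
and concatenation (`mem_openConnIn_trans_of_subset`, `mem_openConnIn_of_mem_edge`) give
`P_{p_c}(0 ↔ x in Λ_{4n}) ≥ p_c q_n³`. CLOSED p163031. [cite: VandenbergDon2020, Lemma 16] -/
theorem stub_vdbdChain :
    ∀ n : ℕ, 1 ≤ n → ∀ x : Site 3, ∀ z : Fin 3 → Site 3,
      (∀ i, z i ∈ box 3 n) →
      (∀ i, (1 : ℝ) / (6 * ((box 3 n).card : ℝ)) ≤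
        (bondPercolation (zdGraph 3) (criticalProbI 3)).real (openConnIn (↑(box 3 n) : Set (Site 3)) 0 (z i))) →
      ∑ c, |x c - ∑ i, z i c| ≤ 1 →
      ((criticalProbI 3 : unitInterval) : ℝ) * ((1 : ℝ) / (6 * ((box 3 n).card : ℝ))) ^ 3 ≤
        (bondPercolation (zdGraph 3) (criticalProbI 3)).real (openConnIn (↑(box 3 (4 * n)) : Set (Site 3)) 0 x) :=
  -- CLOSED: landed as `Theorems.stub_vdbdChain` (p163031, wave 1, lead c13)
  Summit.CriticalPhenomena.PercolationContinuityZ3.Theorems.stub_vdbdChain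

/-- **Frontier stub V6 (`aspectOfTwoArmBdryWide`) — W5 with connection box `Λ_{9n}`** (Cerf 2015 Lemma 7.1
`AKN.real_twoArmsBox_mul_le` with `k = 8n` instead of `k = n`: the count `(1 + |E(Λ_{9n+1})|/p)|Λ_{9n+1}|` has the same
exponent `6`, the boundary-pair union the same exponent `4`; copy-adapt `Theorems.stub_aspectOfTwoArmBdry`, p146647).
CLOSED p162963. [cite: Cerf2015, Lemma 7.1] -/
theorem stub_aspectOfTwoArmBdryWide :
    ∀ p : unitInterval, 0 < (p : ℝ) → ∀ e : ℝ, 0 ≤ e →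
    (∃ c : ℝ, 0 < c ∧ ∀ n : ℕ, 1 ≤ n → ∀ a ∈ box 3 n, ∀ b ∈ box 3 n,
      c * (n : ℝ) ^ (-e) ≤
        (bondPercolation (zdGraph 3) p).real (openConnIn (↑(box 3 (9 * n)) : Set (Site 3)) a b)) →
    ∀ κ : ℝ, 0 < κ →
    (∃ C : ℝ, ∀ i : Fin 3, ∀ m : ℕ, 1 ≤ m →
      (bondPercolation (zdGraph 3) p).real (AKN.edgeTwoArms i m) ≤ C * (m : ℝ) ^ (-κ)) →
    ∀ A : ℝ, 1 < A → 10 + e < κ * A →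
    Filter.Tendsto (fun n : ℕ => (bondPercolation (zdGraph 3) p).real
      {ω | ∃ x ∈ box 3 n, ∃ x' ∈ box 3 n, ∃ y ∈ innerBoundary (zdGraph 3) (box 3 ⌈(n : ℝ) ^ A⌉₊),
        ∃ y' ∈ innerBoundary (zdGraph 3) (box 3 ⌈(n : ℝ) ^ A⌉₊),
          ω ∈ openConnIn ↑(box 3 ⌈(n : ℝ) ^ A⌉₊) x y ∧
          ω ∈ openConnIn ↑(box 3 ⌈(n : ℝ) ^ A⌉₊) x' y' ∧
          ω ∉ openConnIn ↑(box 3 ⌈(n : ℝ) ^ A⌉₊) x x'}) Filter.atTop (nhds 0) :=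
  -- CLOSED: landed as `Theorems.stub_aspectOfTwoArmBdryWide` (p162963, wave 1, lead c13)
  Summit.CriticalPhenomena.PercolationContinuityZ3.Theorems.stub_aspectOfTwoArmBdryWide

/-- The § V stub `Prop`s are the sorried stub theorems' statements (definitional consistency). [folklore] -/
theorem vdbdStubs_consistent :
    (Stubs.stub_vdbdAxisPaths ↔ (Stubs.stub_vdbdGoodPath → Stubs.VdbdAxisPaths)) := Iff.rfl

/-- The spelled-out § V theorems ARE the stub `Prop`s. [folklore] -/
theorem stub_vdbdGoodPath' : Stubs.stub_vdbdGoodPath := stub_vdbdGoodPath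

/-- The spelled-out § V theorems ARE the stub `Prop`s. [folklore] -/
theorem stub_vdbdAxisPaths' : Stubs.stub_vdbdAxisPaths := stub_vdbdAxisPaths

/-- The spelled-out § V theorems ARE the stub `Prop`s. [folklore] -/
theorem stub_vdbdCubeSurj' : Stubs.stub_vdbdCubeSurj := stub_vdbdCubeSurj

/-- The spelled-out § V theorems ARE the stub `Prop`s. [folklore] -/
theorem stub_vdbdChain' : Stubs.stub_vdbdChain := stub_vdbdChain

/-- The spelled-out § V theorems ARE the stub `Prop`s. [folklore] -/
theorem stub_aspectOfTwoArmBdryWide' : Stubs.stub_aspectOfTwoArmBdryWide := stub_aspectOfTwoArmBdryWide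


/-! ### Assembly of § V (lead): van den Berg–Don 2020 Corollary 2 for bond `ℤ³` from V1, V2, V3b, V4 -/

/-- **Step 1 (Lemma 16 for `x ∈ [0,n]³`)**: from the axis-crossing good paths (V2), the covering (V3b) and the chain (V4):
`P_{p_c}(0 ↔ x in Λ_{4n}) ≥ p_c q_n³` for every lattice `x ∈ [0,n]³`, `n ≥ 1` — the signed good points `zᵢ` of the covering
are good (`real_openConnIn_signedPerm_box`) and lie in `Λ_n` (`signedPerm_mem_box_iff`). [cite: VandenbergDon2020, Lemma 16] -/
theorem vdbd_pointToPoint_nonneg (h2 : Stubs.VdbdAxisPaths) (h3 : Stubs.VdbdCovering) (h4 : Stubs.stub_vdbdChain)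
    {n : ℕ} (hn : 1 ≤ n) {x : Site 3} (hx : ∀ c, 0 ≤ x c ∧ x c ≤ n) :
    ((criticalProbI 3 : unitInterval) : ℝ) * Stubs.vdbdQ n ^ 3 ≤
      Stubs.Pc.real (openConnIn (↑(box 3 (4 * n)) : Set (Site 3)) 0 x) := by
  classical
  have hax := fun i => h2 n i
  choose L g hg0 hgL hstep hgood using hax
  obtain ⟨j, hj, ε, hsum⟩ := h3 n L g hg0 hgL hstep (fun i k hk => (hgood i k hk).1) x hx
  set z : Fin 3 → Site 3 := fun i => Site.signedPerm 1 (ε i) (g i (j i)) with hz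
  have hzbox : ∀ i, z i ∈ box 3 n := fun i =>
    (signedPerm_mem_box_iff 1 (ε i)).2 (hgood i (j i) (hj i)).1
  have hzgood : ∀ i, (1 : ℝ) / (6 * ((box 3 n).card : ℝ)) ≤
      Stubs.Pc.real (openConnIn (↑(box 3 n) : Set (Site 3)) 0 (z i)) := fun i => by
    simp only [hz]
    rw [Literature.Barriers.CriticalPhenomena.real_openConnIn_signedPerm_box]
    exact (hgood i (j i) (hj i)).2
  have hzc : ∀ c, ∑ i, z i c = ∑ i, (ε i c : ℤ) * g i (j i) c := fun c => by
    simp [hz, Site.signedPerm_apply, Equiv.Perm.one_def]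
  have hsum' : ∑ c, |x c - ∑ i, z i c| ≤ 1 := by simpa only [hzc] using hsum
  exact h4 n hn x z hzbox hzgood hsum'

/-- **Step 2 (Theorem 1 / Proposition 4 on `Λ_n`)**: `P_{p_c}(0 ↔ x in Λ_{4n}) ≥ p_c q_n³` for every `x ∈ Λ_n`, `n ≥ 1`, by the
sign symmetry `x ↦ |x|` (coordinatewise), `real_openConnIn_signedPerm_box`. [cite: VandenbergDon2020, Theorem 1] -/
theorem vdbd_pointToPoint (h2 : Stubs.VdbdAxisPaths) (h3 : Stubs.VdbdCovering) (h4 : Stubs.stub_vdbdChain)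
    {n : ℕ} (hn : 1 ≤ n) {x : Site 3} (hx : x ∈ box 3 n) :
    ((criticalProbI 3 : unitInterval) : ℝ) * Stubs.vdbdQ n ^ 3 ≤
      Stubs.Pc.real (openConnIn (↑(box 3 (4 * n)) : Set (Site 3)) 0 x) := by
  classical
  set ε : Fin 3 → ℤˣ := fun c => if 0 ≤ x c then 1 else -1 with hε
  set x' : Site 3 := Site.signedPerm 1 ε x with hx'
  have hx'c : ∀ c, x' c = |x c| := fun c => by
    simp only [hx', hε, Site.signedPerm_apply, Equiv.Perm.one_def, Equiv.refl_symm, Equiv.refl_apply]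
    split_ifs with h
    · simp [abs_of_nonneg h]
    · simp [abs_of_neg (not_le.1 h)]
  have hx'nn : ∀ c, 0 ≤ x' c ∧ x' c ≤ n := fun c => by
    rw [hx'c]
    have h := (mem_box.1 hx) c
    exact ⟨abs_nonneg _, abs_le.2 ⟨by linarith [h.1], h.2⟩⟩
  have key := vdbd_pointToPoint_nonneg h2 h3 h4 hn hx'nn
  rwa [hx', Literature.Barriers.CriticalPhenomena.real_openConnIn_signedPerm_box] at key

/-- `q_{2n} ≥ 1/(750 n³)` for `n ≥ 1` (`|Λ_{2n}| = (4n+1)³ ≤ (5n)³`). [folklore] -/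
theorem vdbdQ_two_mul_ge {n : ℕ} (hn : 1 ≤ n) : (1 : ℝ) / (750 * (n : ℝ) ^ 3) ≤ Stubs.vdbdQ (2 * n) := by
  have hn' : (1 : ℝ) ≤ n := by exact_mod_cast hn
  simp only [Stubs.vdbdQ, card_box]
  push_cast
  rw [div_le_div_iff₀ (by positivity) (by positivity), one_mul, one_mul]
  have h1 : (2 * (2 * (n : ℝ)) + 1) ≤ 5 * n := by linarith
  have h2 : (2 * (2 * (n : ℝ)) + 1) ^ 3 ≤ (5 * n) ^ 3 := pow_le_pow_left₀ (by positivity) h1 3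
  nlinarith [h2]

/-- **ASSEMBLY `critPairConnLower9_of` (van den Berg–Don 2020, Corollary 2, bond `ℤ³` at `p_c`)**: from V1, V2, the
covering V3b and V4 — `P_{p_c}(a ↔ b in Λ_{9n}) ≥ c n^{-9}` on `Λ_n²` (`c = p_c/750³`): `b - a ∈ Λ_{2n}`, Step 2 at scale `2n`
(`Λ_{8n}`), translation by `a` (`real_openConnIn_shift_box`) and `a + Λ_{8n} ⊆ Λ_{9n}` (`image_add_box_subset`,
`openConnIn_mono`). [cite: VandenbergDon2020, Corollary 2] -/
theorem critPairConnLower9_of (h1 : Stubs.stub_vdbdGoodPath) (h2 : Stubs.stub_vdbdAxisPaths) (h3 : Stubs.VdbdCovering)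
    (h4 : Stubs.stub_vdbdChain) : Stubs.CritPairConnLower9 := by
  classical
  have hax : Stubs.VdbdAxisPaths := h2 h1
  have hp0 : 0 < ((criticalProbI 3 : unitInterval) : ℝ) := by
    rw [coe_criticalProbI]; exact (Grimmett1999_criticalProb_pos_lt_one_holds 3 (by norm_num)).1
  refine ⟨((criticalProbI 3 : unitInterval) : ℝ) / 750 ^ 3, by positivity, ?_⟩
  intro n hn a ha b hb
  have hn0 : (0 : ℝ) < n := by exact_mod_cast hn
  have hy : b - a ∈ box 3 (2 * n) := by
    rw [mem_box] at ha hb ⊢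
    intro i
    have h1 := ha i
    have h2 := hb i
    simp only [Pi.sub_apply]
    push_cast
    constructor <;> linarith
  have h2n : 1 ≤ 2 * n := by omega
  have key := vdbd_pointToPoint hax h3 h4 h2n hy
  rw [show 4 * (2 * n) = 8 * n by ring] at key
  have hshift := Literature.Barriers.CriticalPhenomena.real_openConnIn_shift_box (criticalProbI 3) a (b - a) (8 * n)
  rw [sub_add_cancel] at hshift
  have hsub : (zdShiftIso a) '' (↑(box 3 (8 * n)) : Set (Site 3)) ⊆ ↑(box 3 (9 * n)) := by
    rw [zdShiftIso_image_box]
    have h := image_add_box_subset (n := 8 * n) ha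
    rw [show n + 8 * n = 9 * n by ring] at h
    exact Finset.coe_subset.2 h
  have hmono : Stubs.Pc.real (openConnIn ((zdShiftIso a) '' (↑(box 3 (8 * n)) : Set (Site 3))) a b) ≤
      Stubs.Pc.real (openConnIn (↑(box 3 (9 * n)) : Set (Site 3)) a b) :=
    measureReal_mono (openConnIn_mono hsub a b) (measure_ne_top _ _)
  have hq := vdbdQ_two_mul_ge hn
  have hq0 : (0 : ℝ) ≤ 1 / (750 * (n : ℝ) ^ 3) := by positivity
  calc ((criticalProbI 3 : unitInterval) : ℝ) / 750 ^ 3 * (n : ℝ) ^ (-(9 : ℝ))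
        = ((criticalProbI 3 : unitInterval) : ℝ) * (1 / (750 * (n : ℝ) ^ 3)) ^ 3 := by
          rw [show (-(9 : ℝ)) = -((9 : ℕ) : ℝ) by norm_num, Real.rpow_neg hn0.le, Real.rpow_natCast]
          field_simp
    _ ≤ ((criticalProbI 3 : unitInterval) : ℝ) * Stubs.vdbdQ (2 * n) ^ 3 := by gcongr
    _ ≤ Stubs.Pc.real (openConnIn (↑(box 3 (8 * n)) : Set (Site 3)) 0 (b - a)) := key
    _ = Stubs.Pc.real (openConnIn ((zdShiftIso a) '' (↑(box 3 (8 * n)) : Set (Site 3))) a b) := hshift.symm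
    _ ≤ Stubs.Pc.real (openConnIn (↑(box 3 (9 * n)) : Set (Site 3)) a b) := hmono

/-! ### Certificates of § V: the frontier with `e = 9` -/

/-- **CERTIFICATE (union form, `e = 9`)**: `CritPairConnLower9` and V6 give `AtExponent A` for every `A > 38`, with the AKN
exponent `κ = (1/2 + 19/A)/2 < 1/2` (`κA = A/4 + 19/2 > 19 = 10 + 9`). [folklore] -/
theorem critAtExponent_of_gt_38 (h9 : Stubs.CritPairConnLower9) (h6 : Stubs.stub_aspectOfTwoArmBdryWide)
    (hhalf : ∀ κ : ℝ, κ < 1 / 2 → Stubs.TwoArm κ) {A : ℝ} (hA : 38 < A) :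
    NearLinearTwoClusterDecay.Negative.AtExponent A := by
  have hp0 : 0 < ((criticalProbI 3 : unitInterval) : ℝ) := by
    rw [coe_criticalProbI]; exact (Grimmett1999_criticalProb_pos_lt_one_holds 3 (by norm_num)).1
  have hA0 : 0 < A := by linarith
  set κ : ℝ := (1 / 2 + 19 / A) / 2 with hκ
  have h19A : 19 / A < 1 / 2 := by rw [div_lt_iff₀ hA0]; linarith
  have hκlt : κ < 1 / 2 := by rw [hκ]; linarith
  have hκ0 : 0 < κ := by rw [hκ]; positivity
  have hκA : 10 + 9 < κ * A := by
    have : κ * A = A / 4 + 19 / 2 := by rw [hκ]; field_simp; ring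
    rw [this]; linarith
  exact h6 (criticalProbI 3) hp0 9 (by norm_num) h9 κ hκ0 (hhalf κ hκlt) A (by linarith) hκA

/-- **CERTIFICATE (union form, `e = 9`, with bond Cerf Thm 1.1 at `p_c`, W2)**: `AtExponent A` for every `A ≥ 38`
(`κ > 1/2` gives `κA ≥ 38κ > 19`). [folklore] -/
theorem critAtExponent_of_ge_38 (h9 : Stubs.CritPairConnLower9) (h6 : Stubs.stub_aspectOfTwoArmBdryWide)
    (h₁ : Stubs.stub_critPairConnLower) (h₂ : Stubs.stub_critTwoArmImproved) {A : ℝ} (hA : 38 ≤ A) :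
    NearLinearTwoClusterDecay.Negative.AtExponent A := by
  have hp0 : 0 < ((criticalProbI 3 : unitInterval) : ℝ) := by
    rw [coe_criticalProbI]; exact (Grimmett1999_criticalProb_pos_lt_one_holds 3 (by norm_num)).1
  obtain ⟨κ, hκ, hT⟩ := h₂ h₁
  have hκ0 : 0 < κ := by linarith
  have hκA : 10 + 9 < κ * A := by nlinarith
  exact h6 (criticalProbI 3) hp0 9 (by norm_num) h9 κ hκ0 hT A (by linarith) hκA

/-- The `e = 9` certificates with the frontier input left as the ONE hypothesis `CritPairConnLower9` (= `critPairConnLower9_of`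
of the four § V pieces) and everything else LANDED (V6 pending): kernel-closed modulo the § V stubs. [folklore] -/
theorem critAtExponent_of_gt_38' (h9 : Stubs.CritPairConnLower9) {A : ℝ} (hA : 38 < A) :
    NearLinearTwoClusterDecay.Negative.AtExponent A :=
  critAtExponent_of_gt_38 h9 stub_aspectOfTwoArmBdryWide'
    (fun _ hκ => NearLinearTwoClusterDecay.RelayBootstrap.twoArm_of_lt_half hκ) hA


/-! ## § Point-to-point frontier, wave 2 (rev L15-c13): the covering step V3b and the pair-form lossy step F1-wide

After wave 1 (V1 p163572, V2 p163280, V3a p163009, V4 p163031, V6 p162963 ALL LANDED) the § V certificates are kernel-closed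
modulo the covering step alone; it is registered here as V3b `stub_vdbdCovering` (statement = `Stubs.VdbdCovering` verbatim), together
with F1-wide `stub_pairAspectOfTwoArmWide` (F1 with connection box `Λ_{9n}`: pair form `κA > 6 + e`, so `PairAtExponent A` for every
`A > 30` / `A ≥ 30` with `e = 9`, against `36`). -/

namespace Stubs

/-- **Frontier stub `Prop` V3b (`vdbdCovering`)** = `VdbdCovering`. -/
def stub_vdbdCovering : Prop := VdbdCovering

/-- **Frontier stub `Prop` F1-wide (`pairAspectOfTwoArmWide`)**: F1 with the pair bound inside the connection box `Λ_{9n}`. -/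
def stub_pairAspectOfTwoArmWide : Prop :=
  ∀ p : unitInterval, 0 < (p : ℝ) → ∀ e : ℝ, 0 ≤ e →
    (∃ c : ℝ, 0 < c ∧ ∀ n : ℕ, 1 ≤ n → ∀ a ∈ box 3 n, ∀ b ∈ box 3 n,
      c * (n : ℝ) ^ (-e) ≤
        (bondPercolation (zdGraph 3) p).real (openConnIn (↑(box 3 (9 * n)) : Set (Site 3)) a b)) →
    ∀ κ : ℝ, 0 < κ →
    (∃ C : ℝ, ∀ i : Fin 3, ∀ m : ℕ, 1 ≤ m →
      (bondPercolation (zdGraph 3) p).real (AKN.edgeTwoArms i m) ≤ C * (m : ℝ) ^ (-κ)) →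
    ∀ A : ℝ, 1 < A → 6 + e < κ * A →
    ∀ ε : ℝ, 0 < ε → ∀ᶠ n : ℕ in Filter.atTop, ∀ x ∈ box 3 n, ∀ x' ∈ box 3 n,
      (bondPercolation (zdGraph 3) p).real
        {ω | ∃ y ∈ innerBoundary (zdGraph 3) (box 3 ⌈(n : ℝ) ^ A⌉₊),
          ∃ y' ∈ innerBoundary (zdGraph 3) (box 3 ⌈(n : ℝ) ^ A⌉₊),
            ω ∈ openConnIn ↑(box 3 ⌈(n : ℝ) ^ A⌉₊) x y ∧
            ω ∈ openConnIn ↑(box 3 ⌈(n : ℝ) ^ A⌉₊) x' y' ∧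
            ω ∉ openConnIn ↑(box 3 ⌈(n : ℝ) ^ A⌉₊) x x'} ≤ ε

end Stubs

/-- **Frontier stub V3b (`vdbdCovering`) — van den Berg–Don 2020 Lemma 14 (with Lemma 12 and Definition 13) for `d = 3`,
deterministic.**  Given, for each axis `i`, a sequence `g i 0, …, g i (L i)` of points of `Λ_n` with `ℓ¹`-steps `≤ 1` from the
face `x_i = -n` to the face `x_i = n`, every lattice `x ∈ [0,n]³` is within `ℓ¹`-distance `1` of `z₁ + z₂ + z₃` with `z_b` a
coordinatewise-signed copy of a point of the `b`-th sequence.  PROOF: polylines `γ_b : [0,1] → ℝ³` through the cast points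
(`Path.trans` of straight segments; `Path.extend` for a map on `ℝ`; range ⊆ union of the segments, so every point of `γ_b` is within
`ℓ¹`-distance `1/2` of a lattice point of the sequence and has all coordinates in `[-n, n]`); the map
`G(t)_i := (γ_i(t_i))_i + | |(γ_j(t_j))_i| - |(γ_k(t_k))_i| |` (`{j,k}` the two other indices) is continuous on the cube with
`G(t)_i ≤ -n + n = 0` at `t_i = 0` and `≥ n` at `t_i = 1`, so by V3a (`Theorems.stub_vdbdCubeSurj`, LANDED p163009) `G(t) = x` for
some `t`; writing `| |u| - |v| | = σ s_u u - σ s_v v` with signs `σ, s_u, s_v ∈ {±1}` gives `x_c = Σ_b ε_{bc} (γ_b(t_b))_c` with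
`ε_{bb} = 1`; replacing each `γ_b(t_b)` by its nearest sequence point `w_b` costs `≤ 3·(1/2)` in `ℓ¹`, and an integer `≤ 3/2` is `≤ 1`.
CLOSED p164298. [cite: VandenbergDon2020, Lemma 14] -/
theorem stub_vdbdCovering :
    ∀ (n : ℕ) (L : Fin 3 → ℕ) (g : Fin 3 → ℕ → Site 3),
      (∀ i, g i 0 i = -(n : ℤ)) → (∀ i, g i (L i) i = n) →
      (∀ i, ∀ j < L i, ∑ c, |g i j c - g i (j + 1) c| ≤ 1) →
      (∀ i, ∀ j ≤ L i, g i j ∈ box 3 n) →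
      ∀ x : Site 3, (∀ c, 0 ≤ x c ∧ x c ≤ n) →
        ∃ j : Fin 3 → ℕ, (∀ i, j i ≤ L i) ∧ ∃ ε : Fin 3 → Fin 3 → ℤˣ,
          ∑ c, |x c - ∑ i, (ε i c : ℤ) * g i (j i) c| ≤ 1 :=
  -- CLOSED: landed as `Theorems.stub_vdbdCovering` (p164298, wave 2, lead c13)
  Summit.CriticalPhenomena.PercolationContinuityZ3.Theorems.stub_vdbdCovering

/-- **Frontier stub F1-wide (`pairAspectOfTwoArmWide`) — F1 (`Theorems.stub_pairAspectOfTwoArm`, p151874) with connection box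
`Λ_{9n}`** (Cerf 2015 Lemma 7.1 with `k = 8n`; count exponent `6` unchanged). CLOSED p164020. [cite: Cerf2015, Lemma 7.1] -/
theorem stub_pairAspectOfTwoArmWide :
    ∀ p : unitInterval, 0 < (p : ℝ) → ∀ e : ℝ, 0 ≤ e →
    (∃ c : ℝ, 0 < c ∧ ∀ n : ℕ, 1 ≤ n → ∀ a ∈ box 3 n, ∀ b ∈ box 3 n,
      c * (n : ℝ) ^ (-e) ≤
        (bondPercolation (zdGraph 3) p).real (openConnIn (↑(box 3 (9 * n)) : Set (Site 3)) a b)) →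
    ∀ κ : ℝ, 0 < κ →
    (∃ C : ℝ, ∀ i : Fin 3, ∀ m : ℕ, 1 ≤ m →
      (bondPercolation (zdGraph 3) p).real (AKN.edgeTwoArms i m) ≤ C * (m : ℝ) ^ (-κ)) →
    ∀ A : ℝ, 1 < A → 6 + e < κ * A →
    ∀ ε : ℝ, 0 < ε → ∀ᶠ n : ℕ in Filter.atTop, ∀ x ∈ box 3 n, ∀ x' ∈ box 3 n,
      (bondPercolation (zdGraph 3) p).real
        {ω | ∃ y ∈ innerBoundary (zdGraph 3) (box 3 ⌈(n : ℝ) ^ A⌉₊),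
          ∃ y' ∈ innerBoundary (zdGraph 3) (box 3 ⌈(n : ℝ) ^ A⌉₊),
            ω ∈ openConnIn ↑(box 3 ⌈(n : ℝ) ^ A⌉₊) x y ∧
            ω ∈ openConnIn ↑(box 3 ⌈(n : ℝ) ^ A⌉₊) x' y' ∧
            ω ∉ openConnIn ↑(box 3 ⌈(n : ℝ) ^ A⌉₊) x x'} ≤ ε :=
  -- CLOSED: landed as `Theorems.stub_pairAspectOfTwoArmWide` (p164020, wave 2, lead c13)
  Summit.CriticalPhenomena.PercolationContinuityZ3.Theorems.stub_pairAspectOfTwoArmWide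

/-- The wave-2 stub `Prop`s are the sorried theorems' statements (definitional consistency). [folklore] -/
theorem vdbdStubs2_consistent :
    (Stubs.stub_vdbdCovering ↔ Stubs.VdbdCovering) := Iff.rfl

/-- The spelled-out theorem IS the stub `Prop` V3b. [folklore] -/
theorem stub_vdbdCovering' : Stubs.stub_vdbdCovering := stub_vdbdCovering

/-- The spelled-out theorem IS the stub `Prop` F1-wide. [folklore] -/
theorem stub_pairAspectOfTwoArmWide' : Stubs.stub_pairAspectOfTwoArmWide := stub_pairAspectOfTwoArmWide

/-- **van den Berg–Don 2020, Corollary 2, bond `ℤ³` — through this line**: `CritPairConnLower9` from V1, V2, V3b, V4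
(kernel-closed once V3b lands). [cite: VandenbergDon2020, Corollary 2] -/
theorem critPairConnLower9' : Stubs.CritPairConnLower9 :=
  critPairConnLower9_of stub_vdbdGoodPath' stub_vdbdAxisPaths' stub_vdbdCovering' stub_vdbdChain'

/-- **CERTIFICATE (union form, `e = 9`, all inputs of this line)**: `AtExponent A` for every `A > 38` (AKN `κ < 1/2`). [folklore] -/
theorem critAtExponent_of_gt_38'' {A : ℝ} (hA : 38 < A) : NearLinearTwoClusterDecay.Negative.AtExponent A :=
  critAtExponent_of_gt_38' critPairConnLower9' hA

/-- **CERTIFICATE (union form, `e = 9`, with W2)**: `AtExponent A` for every `A ≥ 38`. [folklore] -/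
theorem critAtExponent_of_ge_38' {A : ℝ} (hA : 38 ≤ A) : NearLinearTwoClusterDecay.Negative.AtExponent A :=
  critAtExponent_of_ge_38 critPairConnLower9' stub_aspectOfTwoArmBdryWide' stub_critPairConnLower' stub_critTwoArmImproved' hA

/-- **CERTIFICATE (pair form, `e = 9`)**: `CritPairConnLower9` and F1-wide give `PairAtExponent A` for every `A > 30`, with the AKN
exponent `κ = (1/2 + 15/A)/2 < 1/2` (`κA = A/4 + 15/2 > 15 = 6 + 9`). [folklore] -/
theorem critPairAtExponent_of_gt_30 (h9 : Stubs.CritPairConnLower9) (hF : Stubs.stub_pairAspectOfTwoArmWide)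
    (hhalf : ∀ κ : ℝ, κ < 1 / 2 → Stubs.TwoArm κ) {A : ℝ} (hA : 30 < A) : Stubs.PairAtExponent A := by
  have hp0 : 0 < ((criticalProbI 3 : unitInterval) : ℝ) := by
    rw [coe_criticalProbI]; exact (Grimmett1999_criticalProb_pos_lt_one_holds 3 (by norm_num)).1
  have hA0 : 0 < A := by linarith
  set κ : ℝ := (1 / 2 + 15 / A) / 2 with hκ
  have h15A : 15 / A < 1 / 2 := by rw [div_lt_iff₀ hA0]; linarith
  have hκlt : κ < 1 / 2 := by rw [hκ]; linarith
  have hκ0 : 0 < κ := by rw [hκ]; positivity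
  have hκA : 6 + 9 < κ * A := by
    have : κ * A = A / 4 + 15 / 2 := by rw [hκ]; field_simp; ring
    rw [this]; linarith
  exact hF (criticalProbI 3) hp0 9 (by norm_num) h9 κ hκ0 (hhalf κ hκlt) A (by linarith) hκA

/-- **CERTIFICATE (pair form, `e = 9`, with W2)**: `PairAtExponent A` for every `A ≥ 30` (`κ > 1/2` gives `κA ≥ 30κ > 15`). [folklore] -/
theorem critPairAtExponent_of_ge_30 (h9 : Stubs.CritPairConnLower9) (hF : Stubs.stub_pairAspectOfTwoArmWide)
    (h₁ : Stubs.stub_critPairConnLower) (h₂ : Stubs.stub_critTwoArmImproved) {A : ℝ} (hA : 30 ≤ A) :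
    Stubs.PairAtExponent A := by
  have hp0 : 0 < ((criticalProbI 3 : unitInterval) : ℝ) := by
    rw [coe_criticalProbI]; exact (Grimmett1999_criticalProb_pos_lt_one_holds 3 (by norm_num)).1
  obtain ⟨κ, hκ, hT⟩ := h₂ h₁
  have hκ0 : 0 < κ := by linarith
  have hκA : 6 + 9 < κ * A := by nlinarith
  exact hF (criticalProbI 3) hp0 9 (by norm_num) h9 κ hκ0 hT A (by linarith) hκA

/-- The pair-form `e = 9` certificates with all inputs of this line (kernel-closed once V3b and F1-wide land). [folklore] -/
theorem critPairAtExponent_of_gt_30' {A : ℝ} (hA : 30 < A) : Stubs.PairAtExponent A :=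
  critPairAtExponent_of_gt_30 critPairConnLower9' stub_pairAspectOfTwoArmWide'
    (fun _ hκ => NearLinearTwoClusterDecay.RelayBootstrap.twoArm_of_lt_half hκ) hA

/-- The pair-form endpoint `A = 30` with W2. [folklore] -/
theorem critPairAtExponent_of_ge_30' {A : ℝ} (hA : 30 ≤ A) : Stubs.PairAtExponent A :=
  critPairAtExponent_of_ge_30 critPairConnLower9' stub_pairAspectOfTwoArmWide' stub_critPairConnLower' stub_critTwoArmImproved' hA

/-- **Status of the crux family after § V (modulo V3b, F1-wide)**: at `p_c` decay fails at every exponent `≤ 1`, holds at every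
exponent `≥ 38` (union) and the pair form at every exponent `≥ 30`; the crux is the instance `7/6`. [folklore] -/
theorem atExponent_status_38 :
    (∀ A : ℝ, A ≤ 1 → ¬ NearLinearTwoClusterDecay.Negative.AtExponent A) ∧
    (∀ A : ℝ, 38 ≤ A → NearLinearTwoClusterDecay.Negative.AtExponent A) ∧
    (∀ A : ℝ, 30 ≤ A → Stubs.PairAtExponent A) ∧
    (Summit.CriticalPhenomena.PercolationContinuityZ3.Theses.PercShatteringRace.NearLinearTwoClusterDecay ↔
      NearLinearTwoClusterDecay.Negative.AtExponent ((7 : ℝ) / 6)) :=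
  ⟨fun _ hA => NearLinearTwoClusterDecay.Negative.not_atExponent_of_le_one hA, fun _ hA => critAtExponent_of_ge_38' hA,
    fun _ hA => critPairAtExponent_of_ge_30' hA, Iff.rfl⟩

end Summit.CriticalPhenomena.PercolationContinuityZ3.Cruxes.NearLinearTwoClusterDecay.PairDecayLongArmsDense
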